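import Literature.NumberTheory.LFunctions.ZetaZerosShortIntervalsRH
import Literature.NumberTheory.LFunctions.PrimeDirichletPolynomialMoments
import Literature.NumberTheory.LFunctions.DirichletPolynomialMeanValueThm52
import Literature.NumberTheory.LFunctions.ZeroStatisticsProofs
import Literature.NumberTheory.Sieve.SelbergSymmetryFormula
import HarnessLib

/-!
# Moments of the zero count of `ζ` in windows of length `≍ 1/log T`, under RH
# (Bui–Goldston–Milinovich–Montgomery 2023, §3: Lemma 2 and Proposition 2)

Topic `Literature/NumberTheory/LFunctions` (namespace `Literature.NumberTheory.LFunctions`, proof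
objects in `BGMM2023`). PROOF LAYER (cell `landau-siegel`, §C literature harvest, seat
ls-lit-typer-2; row T-005 of `lit/HARVEST.md`): THEOREMS ONLY — no definitions of notions, no named
facts. First of two files discharging the named fact
`Literature.NumberTheory.LFunctions.buiEtAl2023_theorem3` (`ZetaSpacingDensityRH.lean`); this one
formalises the "Selberg moment" half of the printed proof (H. M. Bui, D. A. Goldston,
M. B. Milinovich, H. L. Montgomery, *Small gaps and small spacings between zeta zeros*, Acta Arith.
**210** (2023) 133–153 = arXiv:2208.02359, §3), under Mathlib's `RiemannHypothesis` as an EXPLICIT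
hypothesis of every statement that uses it. LABEL: **NOT RH-BEARING** — RH is the printed
antecedent; nothing here bears on RH or on Landau–Siegel zeros. «The programme SEARCHES and TYPES;
no claim about Landau–Siegel zeros, Theorems 1–2 of arXiv:2211.02515 or a repaired Margin232 until a
kernel theorem says so.»

## What the source prints (held text `paper:arxiv-2208.02359`, chunks p0006–p0008)

With `n(t,λ) = N(t + 2πλ/log T) − N(t)` ((n(t,lambda)), p0005):

> **Lemma 2.** Assume RH. Let `T ≥ 2` be given. If `k ∈ ℕ`, then there is a positive absolute
> constant `C` such that `∫_0^T n(t,k)^{2k} dt < (Ck)^{2k} T`.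

Printed proof (p0007): Lemma 1 (the explicit formula for `Σ_γ sinc²(½(γ−τ)log x)`, `x = T^{1/k}`)
gives `N(τ + πk/log T) − N(τ − πk/log T) ≪ k + (k/log T)|Σ_{n≤x} Λ(n) n^{-1/2}(1 − log n/log x)
cos(τ log n)| + T^{1/2k}/(τ+2)`; raise to the power `2k` and integrate; "by the usual approximate
Parseval identity for Dirichlet polynomials [MV]" and the multinomial theorem the `2k`-th moment of
the prime polynomial is `< (Ck)^k T` ("essentially the same as the proof of Lemma 3 of
Soundararajan [So09]"); the prime squares and higher powers contribute `≪ C^{2k} T`.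

> **Proposition 2.** Assume RH. Suppose that `T ≥ 2` and that `k` is a positive integer. … Then
> there is a positive absolute constant `C` such that `Σ_{0<γ≤T} n(γ,k)^{2k} ≤ (Ck)^{2k} T log T`
> and `Σ_{0<γ≤T} m(γ)^{2k−1} = Σ_{0<γ_d≤T} m(γ_d)^{2k} < (Ck)^{2k−1} T log T`.

Printed proof (p0008): for `γ ∈ I(t) = [t, t + 2π/log T]`, `n(γ,k) ≤ n(t,k+1)`; average over
`t ∈ J(γ) = [γ − 2π/log T, γ]`, sum over `γ`, "the number of `γ ∈ I(t)` is `n(t,1)`", and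
"`n(t,k+1)` is a nonnegative integer, so `n(t,k+1)^{2k+1} ≤ n(t,k+1)^{2k+2}`"; then Lemma 2.

## What is formalised, and how (every analytic input is a tree theorem)

We work with the SYMMETRIC window count `W_h(t) = N(t+h) − N(t−h)` (`N = zetaZeroCount`), which
dominates every one-sided window of the source, and we do not track the `k`-dependence of the
constants (the discharge of Theorem 3 uses `k ≤ 3`).

* `ShortIntervalsRH.zetaZeroCount_short_interval_le_of_RH_sharp` — the tree's Balazard–de Roton
  Prop. 15 (`ShortIntervalsRH.zetaZeroCount_short_interval_le_of_RH`, after Goldston–Gonek 2007;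
  this is the rôle of the printed Lemma 1) with the prime-power term re-estimated: the printed
  `O(log Δ)` (from `|Λ(n) F̂₊| ≤ 4√n`) is replaced by `O(1 + hΔ)` using `|F̂₊(ξ)| ≤ F̂₊(0) = 2h + 1/Δ`
  (`F₊ ≥ 0`, `Literature.Analysis.Fourier.selbergMajorantReal_nonneg`,
  `integral_selbergMajorantReal`) and Mertens' `Σ_{n ≤ y} Λ(n)/n ≤ log y + 6`
  (`Sieve.SelbergSymmetry.abs_sum_vonMangoldt_div_sub_log_le`). In the regime `Δ ≍ log T`,
  `h ≍ 1/log T` of Lemma 2 this is the needed `O(1)`.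
* `BGMM2023.integral_norm_primePoly_pow_le` — the `2k`-th moment of a prime Dirichlet polynomial
  over `[0, T]`: `≤ (T + 928 N^k) · k! · (Σ_p |a_p|²)^k`, from the tree's Montgomery–Vaughan mean
  value theorem (`integral_norm_sq_dirichletPoly_sub_le`, Ivić Thm 5.2) and the multinomial
  bookkeeping `PrimePolyMoments.primePoly_pow_eq` / `sum_norm_sq_powCoeff_le` (the source's "[MV]"
  step, continuous form).
* `BGMM2023.integral_windowCount_pow_le_of_RH` — **Lemma 2 (symmetric window, `k` fixed)**: under
  RH, for every `κ > 0` and `k`, there are `C, T₀` with `∫_T^{2T} W_h(t)^{2k} dt ≤ C T` for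
  `T ≥ T₀` and `0 < h ≤ κ/log T`; and the cumulative form `∫_{T₀}^{T} W_h^{2k} ≤ C T`
  (`BGMM2023.integral_windowCount_pow_le_of_RH_cumulative`, dyadic induction).
* `BGMM2023.sum_windowCount_pow_le_of_RH` — **Proposition 2 (symmetric window, `k` fixed)**:
  under RH, for every `κ > 0` and `j`, there are `C, T₀` with
  `Σ_{n < N(T)} W_δ(γ_n)^j ≤ C T log T` for `T ≥ T₀`, `0 < δ ≤ κ/log T` — by the printed
  averaging over `J(γ) = [γ − w, γ]`, `w = 1/log T`, the count of ordinates in `[t, t+w]` being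
  `≤ W`, and the integer trick `W^{j+1} ≤ W^{2k}`. The multiplicity moment (the second display of
  Proposition 2) is the case where `W_δ(γ_n)` is read as an upper bound for `m(γ_n)`.

## References

* [BuiEtAl2023] H. M. Bui, D. A. Goldston, M. B. Milinovich, H. L. Montgomery, Acta Arith. 210
  (2023) 133–153, arXiv:2208.02359: §3 Lemmas 1–2, Proposition 2 (with proofs).
* [BalazardDeRoton2008] M. Balazard, A. de Roton, arXiv:0810.3587, Prop. 15 (tree:
  `ZetaZerosShortIntervalsRH.lean`); D. A. Goldston, S. M. Gonek, Bull. LMS 39 (2007) 482–486.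
* [Ivic1985] A. Ivić, *The Riemann Zeta-Function* (1985), Thm 5.2 (tree:
  `DirichletPolynomialMeanValueThm52.lean`).
* K. Soundararajan, *Moments of the Riemann zeta function*, Ann. of Math. 170 (2009), Lemma 3.
-/

noncomputable section

open Complex Filter Set MeasureTheory Topology Finset
open scoped Real FourierTransform

namespace Literature.NumberTheory.LFunctions

open Literature.Analysis.Fourier Literature.Analysis.SpecialFunctions ArithmeticFunction

namespace ShortIntervalsRH

open ChebyshevWeighted

/-! ## Prop. 15 with an `O(1 + hΔ)` prime-power term -/

/-- `|Re F̂₊(ξ)| ≤ ‖F̂₊(ξ)‖ ≤ ∫ F₊ = 2h + 1/Δ`: the Fourier transform of the NON-NEGATIVE Selberg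
majorant of `[−h, h]` is bounded by its value at `0`.
[cite: BalazardDeRoton2008, Prop. 10 (ii)] -/
theorem abs_re_fourier_selbergMajorant_le {Δ h : ℝ} (hΔ : 0 < Δ) (hh : 0 ≤ h) (ξ : ℝ) :
    |(𝓕 (fun x : ℝ ↦ selbergMajorant Δ (-h) h x) ξ).re| ≤ 2 * h + 1 / Δ := by
  have hab : -h ≤ h := by linarith
  refine (Complex.abs_re_le_norm _).trans ?_
  rw [Real.fourier_real_eq_integral_exp_smul]
  refine (norm_integral_le_integral_norm _).trans ?_
  have hpt : ∀ v : ℝ, ‖Complex.exp (↑(-2 * π * v * ξ) * I) • selbergMajorant Δ (-h) h (v : ℂ)‖ =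
      selbergMajorantReal Δ (-h) h v := by
    intro v
    rw [norm_smul, Complex.norm_exp_ofReal_mul_I, one_mul, selbergMajorant_ofReal, Complex.norm_real,
      Real.norm_of_nonneg (selbergMajorantReal_nonneg hΔ hab v)]
  simp_rw [hpt]
  rw [integral_selbergMajorantReal hΔ hab]
  apply le_of_eq; ring

/-- **The proper prime powers with the weight `Λ(n)/√n`**: for `X ≥ 2`,
`Σ_{n ≤ X, n = p^k, k ≥ 2} Λ(n)/√n ≤ (7/2)(log X/2 + 6)` — the `p^k` with `k ≥ 2` have
`p ≤ √X`, `Σ_{k≥2} p^{−k/2} ≤ (7/2)/p`, and `Σ_{p ≤ √X} log p/p ≤ Σ_{m ≤ √X} Λ(m)/m ≤ log √X + 6`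
(Mertens). [cite: BuiEtAl2023, Lemma 2 (proof: "The sum over squares of primes is trivially ≪ log x")] -/
theorem sum_properPrimePow_vonMangoldt_div_sqrt_le {X : ℝ} (hX : 2 ≤ X) :
    ∑ n ∈ (Finset.Ioc 0 ⌊X⌋₊).filter (fun n ↦ IsPrimePow n ∧ ¬ n.Prime),
        ((vonMangoldt n : ℝ) / Real.sqrt n) ≤ (7 / 2) * (Real.log X / 2 + 6) := by
  have hX0 : 0 ≤ X := by linarith
  have hX1 : 1 ≤ X := by linarith
  set f : ℕ → ℝ := fun n ↦ if n.Prime then 0 else (vonMangoldt n : ℝ) / Real.sqrt n with hf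
  have h1 : ∑ n ∈ (Finset.Ioc 0 ⌊X⌋₊).filter (fun n ↦ IsPrimePow n ∧ ¬ n.Prime),
      ((vonMangoldt n : ℝ) / Real.sqrt n) = ∑ n ∈ (Finset.Ioc 0 ⌊X⌋₊).filter IsPrimePow, f n := by
    rw [Finset.sum_filter, Finset.sum_filter]
    refine Finset.sum_congr rfl fun n _ ↦ ?_
    by_cases hp : n.Prime <;> by_cases hpp : IsPrimePow n <;> simp [hf, hp, hpp]
  rw [h1, Chebyshev.sum_PrimePow_eq_sum_sum f hX0]
  -- the primes up to `√X`
  set P := (Finset.Ioc 0 ⌊X ^ ((1 : ℝ) / 2)⌋₊).filter Nat.Prime with hP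
  set K := ⌊Real.log X / Real.log 2⌋₊ with hK
  have hinner : ∀ k ∈ Finset.Icc 1 K,
      ∑ p ∈ (Finset.Ioc 0 ⌊X ^ ((1 : ℝ) / k)⌋₊).filter Nat.Prime, f (p ^ k) ≤
        ∑ p ∈ P, (if k = 1 then 0 else (Real.log p * (1 / Real.sqrt p) ^ k : ℝ)) := by
    intro k hk
    rw [Finset.mem_Icc] at hk
    rcases eq_or_ne k 1 with rfl | hk1
    · -- `k = 1`: every term vanishes
      simp only [if_true, Finset.sum_const_zero, pow_one]
      refine le_of_eq (Finset.sum_eq_zero fun p hp ↦ ?_)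
      rw [Finset.mem_filter] at hp
      simp [hf, hp.2]
    have hk2 : 2 ≤ k := by omega
    have hsub : (Finset.Ioc 0 ⌊X ^ ((1 : ℝ) / k)⌋₊).filter Nat.Prime ⊆ P := by
      intro p hp
      rw [Finset.mem_filter, Finset.mem_Ioc] at hp ⊢
      refine ⟨⟨hp.1.1, hp.1.2.trans (Nat.floor_le_floor ?_)⟩, hp.2⟩
      refine Real.rpow_le_rpow_of_exponent_le hX1 ?_
      rw [div_le_div_iff₀ (by exact_mod_cast hk.1 : (0 : ℝ) < k) (by norm_num)]
      rw [one_mul, one_mul]; exact_mod_cast hk2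
    have hterm : ∀ p ∈ P, f (p ^ k) = (if k = 1 then 0 else (Real.log p * (1 / Real.sqrt p) ^ k : ℝ)) := by
      intro p hp
      rw [hP, Finset.mem_filter] at hp
      rw [if_neg hk1]
      simp only [hf, if_neg (not_prime_pow hp.2 hk2)]
      rw [ArithmeticFunction.vonMangoldt_apply_pow (by omega), ArithmeticFunction.vonMangoldt_apply_prime hp.2]
      push_cast
      have hsq : Real.sqrt ((p : ℝ) ^ k) = Real.sqrt p ^ k := by
        rw [Real.sqrt_eq_iff_mul_self_eq (pow_nonneg (by positivity) k) (pow_nonneg (Real.sqrt_nonneg _) k),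
          ← pow_two, ← pow_mul, mul_comm, pow_mul, Real.sq_sqrt (by positivity)]
      rw [hsq, div_eq_mul_one_div, div_pow, one_pow, one_div]
    calc ∑ p ∈ (Finset.Ioc 0 ⌊X ^ ((1 : ℝ) / k)⌋₊).filter Nat.Prime, f (p ^ k)
        ≤ ∑ p ∈ P, f (p ^ k) := Finset.sum_le_sum_of_subset_of_nonneg hsub fun p _ _ ↦ by
          simp only [hf]; split_ifs
          · exact le_rfl
          · exact div_nonneg ArithmeticFunction.vonMangoldt_nonneg (Real.sqrt_nonneg _)
      _ = ∑ p ∈ P, (if k = 1 then 0 else (Real.log p * (1 / Real.sqrt p) ^ k : ℝ)) :=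
          Finset.sum_congr rfl hterm
  refine (Finset.sum_le_sum hinner).trans ?_
  rw [Finset.sum_comm]
  -- for each prime `p ≤ √X`: `Σ_{2 ≤ k ≤ K} log p · p^{-k/2} ≤ (7/2) log p/p`
  have hgeo : ∀ p ∈ P, ∑ k ∈ Finset.Icc 1 K, (if k = 1 then 0 else (Real.log p * (1 / Real.sqrt p) ^ k : ℝ)) ≤
      (7 / 2) * (Real.log p / p) := by
    intro p hp
    rw [hP, Finset.mem_filter] at hp
    have hp2 : (2 : ℝ) ≤ p := by exact_mod_cast hp.2.two_le
    have hlogp : 0 ≤ Real.log p := Real.log_nonneg (by linarith)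
    set r : ℝ := 1 / Real.sqrt p with hr
    have hr0 : 0 ≤ r := by positivity
    have hrle : r ≤ 1 / Real.sqrt 2 := by rw [hr]; gcongr
    have hr2 : r ^ 2 = 1 / p := by rw [hr, div_pow, one_pow, Real.sq_sqrt (by positivity)]
    have hfilt : ∑ k ∈ Finset.Icc 1 K, (if k = 1 then 0 else Real.log p * r ^ k) =
        ∑ k ∈ (Finset.Icc 1 K).filter (· ≠ 1), Real.log p * r ^ k := by
      rw [Finset.sum_filter]
      refine Finset.sum_congr rfl fun k _ ↦ ?_
      by_cases hk : k = 1 <;> simp [hk]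
    have hsub : (Finset.Icc 1 K).filter (· ≠ 1) ⊆ Finset.Ico 2 (K + 1) := by
      intro k hk
      rw [Finset.mem_filter, Finset.mem_Icc] at hk
      rw [Finset.mem_Ico]; omega
    calc ∑ k ∈ Finset.Icc 1 K, (if k = 1 then 0 else Real.log p * r ^ k)
        = ∑ k ∈ (Finset.Icc 1 K).filter (· ≠ 1), Real.log p * r ^ k := hfilt
      _ ≤ ∑ k ∈ Finset.Ico 2 (K + 1), Real.log p * r ^ k :=
          Finset.sum_le_sum_of_subset_of_nonneg hsub fun k _ _ ↦ by positivity
      _ = Real.log p * ∑ k ∈ Finset.Ico 2 (K + 1), r ^ k := by rw [Finset.mul_sum]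
      _ ≤ Real.log p * ((7 / 2) * r ^ 2) :=
          mul_le_mul_of_nonneg_left (geom_tail_le hr0 hrle _) hlogp
      _ = (7 / 2) * (Real.log p / p) := by rw [hr2]; ring
  refine (Finset.sum_le_sum hgeo).trans ?_
  rw [← Finset.mul_sum]
  -- `Σ_{p ≤ √X} log p/p ≤ Σ_{m ≤ √X} Λ(m)/m ≤ log √X + 6`
  have hsqrt1 : (1 : ℝ) ≤ X ^ ((1 : ℝ) / 2) := Real.one_le_rpow hX1 (by norm_num)
  have hM := Literature.NumberTheory.Sieve.SelbergSymmetry.abs_sum_vonMangoldt_div_sub_log_le hsqrt1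
  have hM' := (abs_le.1 hM).2
  have hlog : Real.log (X ^ ((1 : ℝ) / 2)) = Real.log X / 2 := by
    rw [Real.log_rpow (by linarith)]; ring
  rw [hlog] at hM'
  have hle : ∑ p ∈ P, Real.log p / p ≤ ∑ m ∈ Finset.Ioc 0 ⌊X ^ ((1 : ℝ) / 2)⌋₊, (vonMangoldt m : ℝ) / m := by
    rw [hP]
    calc ∑ p ∈ (Finset.Ioc 0 ⌊X ^ ((1 : ℝ) / 2)⌋₊).filter Nat.Prime, Real.log p / p
        = ∑ p ∈ (Finset.Ioc 0 ⌊X ^ ((1 : ℝ) / 2)⌋₊).filter Nat.Prime, (vonMangoldt p : ℝ) / p := by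
          refine Finset.sum_congr rfl fun p hp ↦ ?_
          rw [Finset.mem_filter] at hp
          rw [ArithmeticFunction.vonMangoldt_apply_prime hp.2]
      _ ≤ ∑ m ∈ Finset.Ioc 0 ⌊X ^ ((1 : ℝ) / 2)⌋₊, (vonMangoldt m : ℝ) / m :=
          Finset.sum_le_sum_of_subset_of_nonneg (Finset.filter_subset _ _) fun m _ _ ↦
            div_nonneg ArithmeticFunction.vonMangoldt_nonneg (Nat.cast_nonneg _)
  have h7 : (0 : ℝ) ≤ 7 / 2 := by norm_num
  calc (7 / 2) * ∑ p ∈ P, Real.log p / p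
      ≤ (7 / 2) * ∑ m ∈ Finset.Ioc 0 ⌊X ^ ((1 : ℝ) / 2)⌋₊, (vonMangoldt m : ℝ) / m :=
        mul_le_mul_of_nonneg_left hle h7
    _ ≤ (7 / 2) * (Real.log X / 2 + 6) := mul_le_mul_of_nonneg_left (by linarith) h7

set_option maxHeartbeats 800000 in
/-- **Balazard–de Roton 2008, Prop. 15 (upper bound), under RH, with an `O(1 + hΔ)` remainder**:
with an absolute constant `C`, for `t ≥ 4`, `Δ ≥ 2`, `e^{πΔ} ≤ t`, `0 < h ≤ 1`,
`N(t+h) − N(t−h) − 2h log(t/2π)/(2π) ≤ log t/(2πΔ) − (1/π) Σ_{p ≤ e^{2πΔ}} (log p/√p) F̂₊(log p/2π) cos(t log p) + C(1 + hΔ)`.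
Same proof as the tree's `zetaZeroCount_short_interval_le_of_RH` (explicit formula for `F₊(· − t)`,
archimedean integral, polar terms), except that the proper prime powers are bounded through
`|F̂₊| ≤ 2h + 1/Δ` and `Σ_{n = p^k ≤ e^{2πΔ}, k ≥ 2} Λ(n)/√n ≤ (7/2)(πΔ + 6)` instead of
`|Λ(n)F̂₊(log n/2π)/π| ≤ 4` and Mertens' `Σ 1/p` (which costs `log Δ`). This is the form of the
printed Lemma 1 → (E:Est1) step of [BuiEtAl2023] ("the sum over squares of primes is trivially
`≪ log x`", absorbed by the `1/log x` normalisation).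
[cite: BalazardDeRoton2008, Prop. 15] [cite: BuiEtAl2023, Lemma 2 (proof, (E:Est1))] -/
theorem zetaZeroCount_short_interval_le_of_RH_sharp (hRH : RiemannHypothesis) :
    ∃ C : ℝ, ∀ t Δ h : ℝ, 4 ≤ t → 2 ≤ Δ → Real.exp (π * Δ) ≤ t → 0 < h → h ≤ 1 →
      ((zetaZeroCount (t + h) : ℝ) - zetaZeroCount (t - h)) - 2 * h * Real.log (t / (2 * π)) / (2 * π) ≤
        Real.log t / (2 * π * Δ)
        - (1 / π) * ∑ p ∈ (Finset.Ioc 0 ⌊Real.exp (2 * π * Δ)⌋₊).filter Nat.Prime,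
            Real.log p / Real.sqrt p *
              (𝓕 (fun x : ℝ ↦ selbergMajorant Δ (-h) h x) (Real.log p / (2 * π))).re * Real.cos (t * Real.log p)
        + C * (1 + h * Δ) := by
  obtain ⟨C_E, hCE⟩ := exists_abs_integral_selbergMajorant_reDigammaQuarter_sub_le
  set B₀ : ℝ := 2 + |C_E| / (2 * π) + 7 / (2 * π) * (15 + π) + 7 with hB₀
  have hπ0 : (0 : ℝ) < π := Real.pi_pos
  have hB₀7 : 7 ≤ B₀ := by
    have h1 : 0 ≤ |C_E| / (2 * π) := by positivity
    have h2 : 0 ≤ 7 / (2 * π) * (15 + π) := by positivity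
    rw [hB₀]; linarith
  refine ⟨B₀, fun t Δ h ht hΔ hexp hh0 hh1 ↦ ?_⟩
  have hΔ0 : 0 < Δ := by linarith
  have hΔ1 : 1 ≤ Δ := by linarith
  have hab : -h ≤ h := by linarith
  have htpos : 0 < t := by linarith
  set F : ℂ → ℂ := selbergMajorant Δ (-h) h with hFdef
  obtain ⟨K, hK, hb⟩ := exists_norm_selbergMajorant_le hΔ0 (-h) h
  have hsupp : ∀ ξ : ℝ, Δ ≤ |ξ| → 𝓕 (fun x : ℝ ↦ F x) ξ = 0 := fun ξ hξ ↦
    fourier_selbergMajorant_eq_zero hΔ0 hab hξ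
  have hFreal : ∀ u : ℝ, F ((u : ℝ) : ℂ) = (selbergMajorantReal Δ (-h) h u : ℂ) := fun u ↦
    selbergMajorant_ofReal Δ (-h) h u
  have hAreal := integrable_selbergMajorant_shift_mul_reDigammaQuarter (t := t) hΔ1 ht hh0 hh1
  have hA : Integrable fun u : ℝ ↦ F ((u - t : ℝ) : ℂ) * (reDigammaQuarter u : ℂ) := by
    refine (Complex.ofRealCLM.integrable_comp hAreal).congr (Eventually.of_forall fun u ↦ ?_)
    simp only [Complex.ofRealCLM_apply, Complex.ofReal_mul, hFreal]
  obtain ⟨hZs, hEqn⟩ := tsum_zeros_shift_eq_explicit hRH hΔ0 (differentiable_selbergMajorant Δ (-h) h)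
    hK.le hb hsupp hA
  -- (1) the left-hand side is real and dominates the zero count
  have hterm : ∀ ρ : ZetaZeros.riemannZetaNontrivialZeros,
      (riemannZetaZeroOrder (ρ : ℂ) : ℂ) * F ((((ρ : ℂ).im - t : ℝ)) : ℂ) =
        (((riemannZetaZeroOrder (ρ : ℂ) : ℝ) * selbergMajorantReal Δ (-h) h ((ρ : ℂ).im - t) : ℝ) : ℂ) := by
    intro ρ; rw [hFreal]; push_cast; ring
  have hZs' : Summable fun ρ : ZetaZeros.riemannZetaNontrivialZeros ↦
      (riemannZetaZeroOrder (ρ : ℂ) : ℝ) * selbergMajorantReal Δ (-h) h ((ρ : ℂ).im - t) := by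
    have h1 : Summable fun ρ : ZetaZeros.riemannZetaNontrivialZeros ↦
        |(riemannZetaZeroOrder (ρ : ℂ) : ℝ) * selbergMajorantReal Δ (-h) h ((ρ : ℂ).im - t)| := by
      refine hZs.congr fun ρ ↦ ?_
      rw [hterm, Complex.norm_real, Real.norm_eq_abs]
    exact h1.of_abs
  set Zr : ℝ := ∑' ρ : ZetaZeros.riemannZetaNontrivialZeros,
    (riemannZetaZeroOrder (ρ : ℂ) : ℝ) * selbergMajorantReal Δ (-h) h ((ρ : ℂ).im - t) with hZr
  have hLHS : ∑' ρ : ZetaZeros.riemannZetaNontrivialZeros,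
      (riemannZetaZeroOrder (ρ : ℂ) : ℂ) * F ((((ρ : ℂ).im - t : ℝ)) : ℂ) = (Zr : ℂ) := by
    rw [hZr, Complex.ofReal_tsum]
    exact tsum_congr hterm
  have hcount := zetaZeroCount_sub_le_tsum (t := t) hΔ0 hh0 hZs'
  -- (2) the prime side as a real finite sum
  set N : ℕ := ⌊Real.exp (2 * π * Δ)⌋₊ with hN
  set w : ℝ → ℝ := fun ξ ↦ (𝓕 (fun x : ℝ ↦ F x) ξ).re with hw
  set term : ℕ → ℝ := fun n ↦ (vonMangoldt n : ℝ) / Real.sqrt n * (1 / π * w (Real.log n / (2 * π)) *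
    Real.cos (t * Real.log n)) with htermdef
  have hS : ∑' n : ℕ, ((vonMangoldt n : ℝ) : ℂ) / (Real.sqrt n : ℂ) *
      ((1 / (2 * π) : ℂ) * (Complex.exp (-(t * Real.log n) * I) * 𝓕 (fun x : ℝ ↦ F x) (Real.log n / (2 * π))
        + Complex.exp ((t * Real.log n) * I) * 𝓕 (fun x : ℝ ↦ F x) (-(Real.log n / (2 * π))))) =
      ((∑ n ∈ Finset.Ioc 0 N, term n : ℝ) : ℂ) := by
    rw [tsum_eq_sum (s := Finset.Ioc 0 N)]
    · rw [Complex.ofReal_sum]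
      refine Finset.sum_congr rfl fun n _ ↦ ?_
      simp only [htermdef, hw, hFdef]
      exact primeTerm_eq_ofReal Δ h t n
    · intro n hn
      rw [Finset.mem_Ioc, not_and_or, not_lt, not_le] at hn
      rcases hn with hn | hn
      · have : n = 0 := by omega
        subst this; simp
      · -- `n > e^{2πΔ}`: both Fourier values vanish
        have hn1 : Real.exp (2 * π * Δ) < n := by
          have := Nat.lt_floor_add_one (Real.exp (2 * π * Δ))
          rw [← hN] at this
          exact this.trans_le (by exact_mod_cast hn)
        have hnpos : (0 : ℝ) < n := (Real.exp_pos _).trans hn1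
        have hξ : Δ ≤ |Real.log n / (2 * π)| := by
          rw [abs_of_pos (div_pos (Real.log_pos (by
            have : (1 : ℝ) < Real.exp (2 * π * Δ) := by
              have : (0:ℝ) < 2 * π * Δ := by positivity
              exact Real.one_lt_exp_iff.2 this
            linarith)) (by positivity))]
          rw [le_div_iff₀ (by positivity), ← Real.log_exp (Δ * (2 * π))]
          refine Real.log_le_log (Real.exp_pos _) ?_
          rw [show Δ * (2 * π) = 2 * π * Δ by ring]; exact hn1.le
        have hξ' : Δ ≤ |-(Real.log n / (2 * π))| := by rwa [abs_neg]
        rw [hsupp _ hξ, hsupp _ hξ']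
        simp
  -- split the finite sum: primes / proper prime powers / the rest
  have hsplit : ∑ n ∈ Finset.Ioc 0 N, term n =
      ∑ p ∈ (Finset.Ioc 0 N).filter Nat.Prime, term p +
        ∑ n ∈ (Finset.Ioc 0 N).filter (fun n ↦ IsPrimePow n ∧ ¬ n.Prime), term n := by
    rw [← Finset.sum_filter_add_sum_filter_not (Finset.Ioc 0 N) Nat.Prime term]
    congr 1
    rw [← Finset.sum_filter_add_sum_filter_not ((Finset.Ioc 0 N).filter (fun n ↦ ¬ n.Prime)) IsPrimePow term]
    have hzero : ∑ n ∈ ((Finset.Ioc 0 N).filter (fun n ↦ ¬ n.Prime)).filter (fun n ↦ ¬ IsPrimePow n), term n = 0 := by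
      refine Finset.sum_eq_zero fun n hn ↦ ?_
      rw [Finset.mem_filter] at hn
      simp only [htermdef, ArithmeticFunction.vonMangoldt_eq_zero_iff.2 hn.2, zero_div, zero_mul]
    rw [hzero, add_zero, Finset.filter_filter]
    refine Finset.sum_congr ?_ fun _ _ ↦ rfl
    ext n; simp only [Finset.mem_filter]; tauto
  have hprimes : ∑ p ∈ (Finset.Ioc 0 N).filter Nat.Prime, term p =
      (1 / π) * ∑ p ∈ (Finset.Ioc 0 N).filter Nat.Prime,
        Real.log p / Real.sqrt p * w (Real.log p / (2 * π)) * Real.cos (t * Real.log p) := by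
    rw [Finset.mul_sum]
    refine Finset.sum_congr rfl fun p hp ↦ ?_
    rw [Finset.mem_filter] at hp
    simp only [htermdef, ArithmeticFunction.vonMangoldt_apply_prime hp.2]
    ring
  -- the proper prime powers: `|Σ term| ≤ (1/π)(2h + 1/Δ) Σ Λ(n)/√n ≤ (1/π)(2h + 1/Δ)(7/2)(πΔ + 6)`
  have hX2 : (2 : ℝ) ≤ Real.exp (2 * π * Δ) := by
    have : (2 : ℝ) ≤ 2 * π * Δ + 1 := by nlinarith [Real.pi_gt_three]
    exact this.trans (Real.add_one_le_exp _)
  have hpp : |∑ n ∈ (Finset.Ioc 0 N).filter (fun n ↦ IsPrimePow n ∧ ¬ n.Prime), term n| ≤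
      (1 / π) * (2 * h + 1 / Δ) * ((7 / 2) * (π * Δ + 6)) := by
    refine (Finset.abs_sum_le_sum_abs _ _).trans ?_
    have hle : ∀ n ∈ (Finset.Ioc 0 N).filter (fun n ↦ IsPrimePow n ∧ ¬ n.Prime),
        |term n| ≤ (1 / π) * (2 * h + 1 / Δ) * ((vonMangoldt n : ℝ) / Real.sqrt n) := by
      intro n hn
      have hΛ0 : (0 : ℝ) ≤ vonMangoldt n := ArithmeticFunction.vonMangoldt_nonneg
      have hw' : |w (Real.log n / (2 * π))| ≤ 2 * h + 1 / Δ := by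
        simp only [hw, hFdef]
        exact abs_re_fourier_selbergMajorant_le hΔ0 hh0.le _
      have hcos : |Real.cos (t * Real.log n)| ≤ 1 := Real.abs_cos_le_one _
      simp only [htermdef]
      rw [abs_mul, abs_div, abs_of_nonneg hΛ0, abs_of_nonneg (Real.sqrt_nonneg _), abs_mul, abs_mul,
        abs_of_pos (by positivity : (0 : ℝ) < 1 / π)]
      have h0 : 0 ≤ (vonMangoldt n : ℝ) / Real.sqrt n := div_nonneg hΛ0 (Real.sqrt_nonneg _)
      calc (vonMangoldt n : ℝ) / Real.sqrt n * (1 / π * |w (Real.log n / (2 * π))| * |Real.cos (t * Real.log n)|)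
          ≤ (vonMangoldt n : ℝ) / Real.sqrt n * (1 / π * (2 * h + 1 / Δ) * 1) := by
            refine mul_le_mul_of_nonneg_left ?_ h0
            refine mul_le_mul ?_ hcos (abs_nonneg _) (by positivity)
            exact mul_le_mul_of_nonneg_left hw' (by positivity)
        _ = (1 / π) * (2 * h + 1 / Δ) * ((vonMangoldt n : ℝ) / Real.sqrt n) := by ring
    calc ∑ n ∈ (Finset.Ioc 0 N).filter (fun n ↦ IsPrimePow n ∧ ¬ n.Prime), |term n|
        ≤ ∑ n ∈ (Finset.Ioc 0 N).filter (fun n ↦ IsPrimePow n ∧ ¬ n.Prime),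
            (1 / π) * (2 * h + 1 / Δ) * ((vonMangoldt n : ℝ) / Real.sqrt n) := Finset.sum_le_sum hle
      _ = (1 / π) * (2 * h + 1 / Δ) * ∑ n ∈ (Finset.Ioc 0 N).filter (fun n ↦ IsPrimePow n ∧ ¬ n.Prime),
            ((vonMangoldt n : ℝ) / Real.sqrt n) := by rw [Finset.mul_sum]
      _ ≤ (1 / π) * (2 * h + 1 / Δ) * ((7 / 2) * (Real.log (Real.exp (2 * π * Δ)) / 2 + 6)) := by
          refine mul_le_mul_of_nonneg_left ?_ (by positivity)
          rw [hN]
          exact sum_properPrimePow_vonMangoldt_div_sqrt_le hX2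
      _ = (1 / π) * (2 * h + 1 / Δ) * ((7 / 2) * (π * Δ + 6)) := by
          rw [Real.log_exp]; ring
  have hpp_num : (1 / π) * (2 * h + 1 / Δ) * ((7 / 2) * (π * Δ + 6)) ≤ 7 / (2 * π) * (15 + π) + 7 * (h * Δ) := by
    have h6Δ : 6 / Δ ≤ 3 := by rw [div_le_iff₀ hΔ0]; linarith
    have hexpand : (1 / π) * (2 * h + 1 / Δ) * ((7 / 2) * (π * Δ + 6)) =
        7 * (h * Δ) + 7 / (2 * π) * (12 * h + π + 6 / Δ) := by
      field_simp
      ring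
    rw [hexpand]
    have h3 : 12 * h + π + 6 / Δ ≤ 15 + π := by linarith
    have h4 : 0 ≤ 7 / (2 * π) := by positivity
    nlinarith [mul_le_mul_of_nonneg_left h3 h4]
  -- (3) the archimedean side is real and bounded
  have hF0 : 𝓕 (fun x : ℝ ↦ F x) 0 = ((2 * h + 1 / Δ : ℝ) : ℂ) := by
    rw [hFdef, fourier_selbergMajorant_zero hΔ0 hab]
    congr 1; ring
  have hIint : (∫ u : ℝ, F ((u - t : ℝ) : ℂ) * (reDigammaQuarter u : ℂ)) =
      ((∫ u : ℝ, selbergMajorantReal Δ (-h) h (u - t) * reDigammaQuarter u : ℝ) : ℂ) := by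
    rw [← integral_complex_ofReal]
    refine integral_congr_ae (Eventually.of_forall fun u ↦ ?_)
    simp only [hFreal, Complex.ofReal_mul]
  set Ir : ℝ := ∫ u : ℝ, selbergMajorantReal Δ (-h) h (u - t) * reDigammaQuarter u with hIr
  have hIr : Ir ≤ (2 * h + 1 / Δ) * Real.log (t / 2) + |C_E| := by
    have := hCE Δ t h hΔ1 ht hh0 hh1
    have h2 := (abs_le.1 this).2
    linarith [le_abs_self C_E]
  have hArch : ((1 / (2 * π) : ℂ) * (∫ u : ℝ, F ((u - t : ℝ) : ℂ) * (reDigammaQuarter u : ℂ))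
      - (1 / (2 * π) : ℂ) * 𝓕 (fun x : ℝ ↦ F x) 0 * (Real.log π : ℂ)) =
      ((1 / (2 * π) * (Ir - (2 * h + 1 / Δ) * Real.log π) : ℝ) : ℂ) := by
    rw [hIint, hF0]; push_cast; ring
  have hArch_le : 1 / (2 * π) * (Ir - (2 * h + 1 / Δ) * Real.log π) ≤
      2 * h * Real.log (t / (2 * π)) / (2 * π) + Real.log t / (2 * π * Δ) + |C_E| / (2 * π) := by
    have hlogsplit : Real.log (t / 2) - Real.log π = Real.log (t / (2 * π)) := by
      rw [← Real.log_div (by positivity) Real.pi_ne_zero]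
      congr 1; field_simp
    have h1 : Ir - (2 * h + 1 / Δ) * Real.log π ≤ (2 * h + 1 / Δ) * Real.log (t / (2 * π)) + |C_E| := by
      rw [← hlogsplit]; nlinarith
    have h2 : (1 / Δ) * Real.log (t / (2 * π)) ≤ (1 / Δ) * Real.log t := by
      refine mul_le_mul_of_nonneg_left (Real.log_le_log (by positivity) ?_) (by positivity)
      rw [div_le_iff₀ (by positivity)]; nlinarith [Real.pi_gt_three]
    have hπ2 : (0 : ℝ) < 1 / (2 * π) := by positivity
    calc 1 / (2 * π) * (Ir - (2 * h + 1 / Δ) * Real.log π)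
        ≤ 1 / (2 * π) * ((2 * h + 1 / Δ) * Real.log (t / (2 * π)) + |C_E|) :=
          mul_le_mul_of_nonneg_left h1 hπ2.le
      _ = 2 * h * Real.log (t / (2 * π)) / (2 * π) + 1 / (2 * π) * ((1 / Δ) * Real.log (t / (2 * π))) +
            |C_E| / (2 * π) := by ring
      _ ≤ 2 * h * Real.log (t / (2 * π)) / (2 * π) + 1 / (2 * π) * ((1 / Δ) * Real.log t) + |C_E| / (2 * π) := by
          gcongr
      _ = _ := by field_simp
  -- (4) the polar side
  have hP : (selbergMajorant Δ (-h) h (I / 2 - t)).re + (selbergMajorant Δ (-h) h (-(I / 2) - t)).re ≤ 2 := by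
    have h1 := norm_selbergMajorant_polar_le (Δ := Δ) (t := t) ht hΔ hexp hh0 hh1 1 (Or.inl rfl)
    have h2 := norm_selbergMajorant_polar_le (Δ := Δ) (t := t) ht hΔ hexp hh0 hh1 (-1) (Or.inr rfl)
    simp only [Complex.ofReal_one, one_mul, Complex.ofReal_neg, neg_one_mul] at h1 h2
    have h3 := (Complex.re_le_norm (selbergMajorant Δ (-h) h (I / 2 - t))).trans h1
    have h4 := (Complex.re_le_norm (selbergMajorant Δ (-h) h (-(I / 2) - t))).trans h2
    linarith
  -- (5) assemble
  rw [hLHS, hS, hArch] at hEqn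
  have hre := congrArg Complex.re hEqn
  simp only [Complex.ofReal_re, Complex.sub_re, Complex.add_re] at hre
  rw [hsplit, hprimes] at hre
  have hpp' := (abs_le.1 hpp).1
  have hfinal : Zr ≤ 2 - (1 / π) * ∑ p ∈ (Finset.Ioc 0 N).filter Nat.Prime,
        Real.log p / Real.sqrt p * w (Real.log p / (2 * π)) * Real.cos (t * Real.log p)
      + (7 / (2 * π) * (15 + π) + 7 * (h * Δ))
      + (2 * h * Real.log (t / (2 * π)) / (2 * π) + Real.log t / (2 * π * Δ) + |C_E| / (2 * π)) := by
    linarith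
  have hhΔ : 0 ≤ h * Δ := by positivity
  have hCbound : 2 + (7 / (2 * π) * (15 + π) + 7 * (h * Δ)) + |C_E| / (2 * π) ≤ B₀ * (1 + h * Δ) := by
    have h7 : 7 * (h * Δ) ≤ B₀ * (h * Δ) := mul_le_mul_of_nonneg_right hB₀7 hhΔ
    have hc : 2 + 7 / (2 * π) * (15 + π) + |C_E| / (2 * π) ≤ B₀ := by rw [hB₀]; linarith
    nlinarith
  calc ((zetaZeroCount (t + h) : ℝ) - zetaZeroCount (t - h)) - 2 * h * Real.log (t / (2 * π)) / (2 * π)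
      ≤ Zr - 2 * h * Real.log (t / (2 * π)) / (2 * π) := by linarith
    _ ≤ Real.log t / (2 * π * Δ)
        - (1 / π) * ∑ p ∈ (Finset.Ioc 0 N).filter Nat.Prime,
            Real.log p / Real.sqrt p * w (Real.log p / (2 * π)) * Real.cos (t * Real.log p)
        + B₀ * (1 + h * Δ) := by linarith

end ShortIntervalsRH

namespace BGMM2023

open PrimePolyMoments

/-! ## The `2k`-th moment of a prime Dirichlet polynomial over `[0, T]` -/

/-- **The "[MV] + multinomial" step of the printed Lemma 2, continuous form**: for primes
`S ⊆ [1, N]`, complex `a_p`, `k ∈ ℕ` and `T ≥ 0`,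
`∫_0^T |Σ_{p∈S} a_p p^{it}|^{2k} dt ≤ (T + 928 N^k) · k! · (Σ_{p∈S} |a_p|²)^k` —
`P^k = Σ_{n ≤ N^k} b(n) n^{it}` with `Σ |b(n)|² ≤ k! (Σ |a_p|²)^k`
(`PrimePolyMoments.primePoly_pow_eq`, `sum_norm_sq_powCoeff_le`), and the Montgomery–Vaughan mean
value theorem `∫_0^T |Σ b(n) n^{it}|² = (T + O(n)) Σ|b(n)|²` in Ivić's explicit form
(`integral_norm_sq_dirichletPoly_sub_le`). [cite: BuiEtAl2023, Lemma 2 (proof)]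
[cite: Ivic1985, Theorem 5.2] -/
theorem integral_norm_primePoly_pow_le (S : Finset ℕ) (hS : ∀ p ∈ S, p.Prime) {N : ℕ} (hN : 1 ≤ N)
    (hSN : ∀ p ∈ S, p ≤ N) (a : ℕ → ℂ) (k : ℕ) {T : ℝ} (hT : 0 ≤ T) :
    ∫ t in (0 : ℝ)..T, ‖∑ p ∈ S, a p * (p : ℂ) ^ ((t : ℂ) * I)‖ ^ (2 * k) ≤
      (T + 928 * (N : ℝ) ^ k) * (k.factorial * (∑ p ∈ S, ‖a p‖ ^ 2) ^ k) := by
  have hS1 : ∀ p ∈ S, 1 ≤ p := fun p hp ↦ (hS p hp).one_lt.le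
  -- `|P(t)|^{2k} = |Σ b(n) n^{it}|²`
  have hpow : ∀ t : ℝ, ‖∑ p ∈ S, a p * (p : ℂ) ^ ((t : ℂ) * I)‖ ^ (2 * k) =
      ‖∑ n ∈ Finset.Icc 1 (N ^ k), powCoeff S a k n * (n : ℂ) ^ ((t : ℂ) * I)‖ ^ 2 := by
    intro t
    rw [← primePoly_pow_eq hS1 hSN a, norm_pow, ← pow_mul, mul_comm k 2]
  simp_rw [hpow]
  have hmv := integral_norm_sq_dirichletPoly_sub_le (N ^ k) (powCoeff S a k) T
  have hcoef := sum_norm_sq_powCoeff_le (k := k) hS hSN a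
  have hB0 : 0 ≤ ∑ n ∈ Finset.Icc 1 (N ^ k), ‖powCoeff S a k n‖ ^ 2 :=
    Finset.sum_nonneg fun n _ ↦ by positivity
  -- `Σ n |b(n)|² ≤ N^k Σ |b(n)|²`
  have hwt : ∑ n ∈ Finset.Icc 1 (N ^ k), (n : ℝ) * ‖powCoeff S a k n‖ ^ 2 ≤
      (N : ℝ) ^ k * ∑ n ∈ Finset.Icc 1 (N ^ k), ‖powCoeff S a k n‖ ^ 2 := by
    rw [Finset.mul_sum]
    refine Finset.sum_le_sum fun n hn ↦ ?_
    have hnN : (n : ℝ) ≤ (N : ℝ) ^ k := by exact_mod_cast (Finset.mem_Icc.1 hn).2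
    exact mul_le_mul_of_nonneg_right hnN (by positivity)
  have h1 := (abs_le.1 hmv).2
  calc ∫ t in (0 : ℝ)..T, ‖∑ n ∈ Finset.Icc 1 (N ^ k), powCoeff S a k n * (n : ℂ) ^ ((t : ℂ) * I)‖ ^ 2
      ≤ T * ∑ n ∈ Finset.Icc 1 (N ^ k), ‖powCoeff S a k n‖ ^ 2 +
          928 * ((N : ℝ) ^ k * ∑ n ∈ Finset.Icc 1 (N ^ k), ‖powCoeff S a k n‖ ^ 2) := by linarith
    _ = (T + 928 * (N : ℝ) ^ k) * ∑ n ∈ Finset.Icc 1 (N ^ k), ‖powCoeff S a k n‖ ^ 2 := by ring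
    _ ≤ (T + 928 * (N : ℝ) ^ k) * (k.factorial * (∑ p ∈ S, ‖a p‖ ^ 2) ^ k) :=
        mul_le_mul_of_nonneg_left hcoef (by positivity)

/-! ## Elementary lemmas -/

/-- `(a + b)^n ≤ 2^n (a^n + b^n)` for `a, b ≥ 0`. [folklore] -/
private theorem add_pow_le_two_pow_mul {a b : ℝ} (ha : 0 ≤ a) (hb : 0 ≤ b) (n : ℕ) :
    (a + b) ^ n ≤ 2 ^ n * (a ^ n + b ^ n) := by
  have h1 : a + b ≤ 2 * max a b := by
    rcases le_total a b with h | h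
    · rw [max_eq_right h]; linarith
    · rw [max_eq_left h]; linarith
  have h2 : (max a b) ^ n ≤ a ^ n + b ^ n := by
    rcases le_total a b with h | h
    · rw [max_eq_right h]; linarith [pow_nonneg ha n]
    · rw [max_eq_left h]; linarith [pow_nonneg hb n]
  calc (a + b) ^ n ≤ (2 * max a b) ^ n := pow_le_pow_left₀ (by positivity) h1 n
    _ = 2 ^ n * (max a b) ^ n := mul_pow _ _ _
    _ ≤ 2 ^ n * (a ^ n + b ^ n) := mul_le_mul_of_nonneg_left h2 (by positivity)

/-- A measurable function bounded on `[a, b]` is interval integrable. [folklore] -/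
private theorem intervalIntegrable_of_bounded {f : ℝ → ℝ} {a b C : ℝ} (hab : a ≤ b) (hf : Measurable f)
    (h : ∀ t ∈ Set.Icc a b, |f t| ≤ C) : IntervalIntegrable f volume a b := by
  rw [intervalIntegrable_iff_integrableOn_Icc_of_le hab]
  refine Measure.integrableOn_of_bounded (M := C) measure_Icc_lt_top.ne hf.aestronglyMeasurable ?_
  rw [ae_restrict_iff' measurableSet_Icc]
  exact Eventually.of_forall fun t ht ↦ by rw [Real.norm_eq_abs]; exact h t ht

/-- The symmetric window count `W_h(t) = N(t+h) − N(t−h)` is measurable in `t` (`N` is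
non-decreasing). [cite: Titchmarsh1986, §9.1] -/
theorem measurable_windowCount (h : ℝ) :
    Measurable fun t : ℝ ↦ ((zetaZeroCount (t + h) : ℝ) - zetaZeroCount (t - h)) := by
  have h1 : Monotone fun t : ℝ ↦ (zetaZeroCount (t + h) : ℝ) := fun x y hxy ↦ by
    have := zetaZeroCount_mono (show x + h ≤ y + h by linarith)
    show (zetaZeroCount (x + h) : ℝ) ≤ zetaZeroCount (y + h)
    exact_mod_cast this
  have h2 : Monotone fun t : ℝ ↦ (zetaZeroCount (t - h) : ℝ) := fun x y hxy ↦ by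
    have := zetaZeroCount_mono (show x - h ≤ y - h by linarith)
    show (zetaZeroCount (x - h) : ℝ) ≤ zetaZeroCount (y - h)
    exact_mod_cast this
  exact h1.measurable.sub h2.measurable

/-- `0 ≤ W_h(t)` for `h ≥ 0` (`N` is non-decreasing). [cite: Titchmarsh1986, §9.1] -/
theorem windowCount_nonneg {h : ℝ} (hh : 0 ≤ h) (t : ℝ) :
    0 ≤ ((zetaZeroCount (t + h) : ℝ) - zetaZeroCount (t - h)) := by
  have := zetaZeroCount_mono (show t - h ≤ t + h by linarith)
  have : (zetaZeroCount (t - h) : ℝ) ≤ zetaZeroCount (t + h) := by exact_mod_cast this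
  linarith

/-- `W_h(t) ≤ N(b)` whenever `t + h ≤ b` (`N` is non-decreasing and `≥ 0`). [cite: Titchmarsh1986, §9.1] -/
theorem windowCount_le {h t b : ℝ} (htb : t + h ≤ b) :
    ((zetaZeroCount (t + h) : ℝ) - zetaZeroCount (t - h)) ≤ zetaZeroCount b := by
  have h1 : (zetaZeroCount (t + h) : ℝ) ≤ zetaZeroCount b := by exact_mod_cast zetaZeroCount_mono htb
  have h2 : (0 : ℝ) ≤ zetaZeroCount (t - h) := Nat.cast_nonneg _
  linarith

/-! ## Lemma 2: `∫_T^{2T} W_h(t)^{2k} dt ≪ T` for `h ≍ 1/log T`, under RH -/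

/-- `Re (p^{it}) = cos(t log p)` for `p ≥ 1`. [folklore] -/
private theorem re_natCast_cpow_mul_I {p : ℕ} (hp : p ≠ 0) (t : ℝ) :
    ((p : ℂ) ^ ((t : ℂ) * I)).re = Real.cos (t * Real.log p) := by
  rw [natCast_cpow_mul_I_eq_cexp hp, show (↑(Real.log p) * I * ↑t : ℂ) = ↑(t * Real.log p) * I by
    push_cast; ring, Complex.exp_ofReal_mul_I_re]

/-- The prime Dirichlet polynomial `t ↦ Σ_{p∈S} a_p p^{it}` is continuous. [folklore] -/
private theorem continuous_primePoly (S : Finset ℕ) (hS : ∀ p ∈ S, p ≠ 0) (a : ℕ → ℂ) :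
    Continuous fun t : ℝ ↦ ∑ p ∈ S, a p * (p : ℂ) ^ ((t : ℂ) * I) := by
  refine continuous_finsetSum _ fun p hp ↦ ?_
  refine continuous_const.mul ?_
  have hc : Continuous fun t : ℝ ↦ ((t : ℂ) * I) := by fun_prop
  exact hc.const_cpow (Or.inl (by exact_mod_cast hS p hp))

set_option maxHeartbeats 1600000 in
/-- **Bui–Goldston–Milinovich–Montgomery 2023, Lemma 2 (symmetric window, `k` fixed), under RH.**
For every `κ > 0` and `k ≥ 1` there are `C ≥ 0` and `T₀ ≥ 4` such that for all `T ≥ T₀` and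
`0 < h ≤ κ/log T`,
`∫_T^{2T} (N(t+h) − N(t−h))^{2k} dt ≤ C · T`.
Printed: "`∫_0^T n(t,k)^{2k} dt < (Ck)^{2k} T`" for the one-sided window of length `2πk/log T`;
here the window is symmetric of any length `2h ≤ 2κ/log T`, the range is dyadic, and the
`k`-dependence of the constant is not tracked. Proof as printed: the Goldston–Gonek / Selberg
window inequality with `Δ = log T/(2πk)` (`ShortIntervalsRH.zetaZeroCount_short_interval_le_of_RH_sharp`)
gives `N(t+h) − N(t−h) ≤ A + |P(t)|/π` on `[T, 2T]` with `P(t) = Σ_{p ≤ e^{2πΔ}} a_p p^{it}`,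
`Σ_p a_p² = O(1)`; then `(A + |P|/π)^{2k} ≤ 2^{2k}(A^{2k} + (|P|/π)^{2k})` and the `2k`-th moment
of `P` (`integral_norm_primePoly_pow_le`, length `(e^{2πΔ})^k = T`).
[cite: BuiEtAl2023, Lemma 2] -/
theorem integral_windowCount_pow_le_of_RH (hRH : RiemannHypothesis) {κ : ℝ} (hκ : 0 < κ)
    {k : ℕ} (hk : 1 ≤ k) :
    ∃ C T₀ : ℝ, 0 ≤ C ∧ 4 ≤ T₀ ∧ ∀ T : ℝ, T₀ ≤ T → ∀ h : ℝ, 0 < h → h ≤ κ / Real.log T →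
      ∫ t in T..2 * T, ((zetaZeroCount (t + h) : ℝ) - zetaZeroCount (t - h)) ^ (2 * k) ≤ C * T := by
  obtain ⟨C₁, hC₁⟩ := ShortIntervalsRH.zetaZeroCount_short_interval_le_of_RH_sharp hRH
  have hπ0 : 0 < π := Real.pi_pos
  have hπ3 := Real.pi_gt_three
  have hk0 : (0 : ℝ) < k := by exact_mod_cast hk
  have hk1 : (1 : ℝ) ≤ k := by exact_mod_cast hk
  -- constants
  set A : ℝ := 2 * κ / π + 2 * k + |C₁| * (1 + κ) with hA
  have hA0 : 0 ≤ A := by positivity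
  set Ba : ℝ := (2 * κ + 1) ^ 2 * (2 * π * (2 * π + 3)) with hBa
  have hBa0 : 0 ≤ Ba := by positivity
  set C : ℝ := 2 ^ (2 * k) * A ^ (2 * k) + (2 / π) ^ (2 * k) * (930 * (k.factorial * Ba ^ k)) with hC
  set T₀ : ℝ := max (Real.exp (4 * π * k)) (max (Real.exp κ) 4) with hT₀
  refine ⟨C, T₀, by positivity, (le_max_right _ _).trans (le_max_right _ _), fun T hT h hh0 hhκ ↦ ?_⟩
  -- unpack `T ≥ T₀`
  have hT4 : 4 ≤ T := ((le_max_right _ _).trans (le_max_right _ _)).trans hT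
  have hT0 : 0 < T := by linarith
  have hTexpk : Real.exp (4 * π * k) ≤ T := (le_max_left _ _).trans hT
  have hTexpκ : Real.exp κ ≤ T := ((le_max_left _ _).trans (le_max_right _ _)).trans hT
  have hlogT : 4 * π * k ≤ Real.log T := by
    rw [← Real.log_exp (4 * π * k)]; exact Real.log_le_log (Real.exp_pos _) hTexpk
  have hκlog : κ ≤ Real.log T := by
    rw [← Real.log_exp κ]; exact Real.log_le_log (Real.exp_pos _) hTexpκ
  have hlogT0 : 0 < Real.log T := Real.log_pos (by linarith)
  have hlog2T : Real.log (2 * T) ≤ 2 * Real.log T := by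
    rw [Real.log_mul (by norm_num) hT0.ne']
    have : Real.log 2 ≤ Real.log T := Real.log_le_log (by norm_num) (by linarith)
    linarith
  have hh1 : h ≤ 1 := hhκ.trans ((div_le_one hlogT0).2 hκlog)
  have hhlog : h * Real.log T ≤ κ := by rwa [← le_div_iff₀ hlogT0]
  -- `Δ = log T/(2πk)`
  set Δ : ℝ := Real.log T / (2 * π * k) with hΔdef
  have h2πk : (0 : ℝ) < 2 * π * k := by positivity
  have hΔ2 : 2 ≤ Δ := by rw [hΔdef, le_div_iff₀ h2πk]; linarith
  have hΔ0 : 0 < Δ := by linarith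
  have h2πΔ : 2 * π * Δ = Real.log T / k := by rw [hΔdef]; field_simp
  have hhΔ : h * Δ ≤ κ := by
    have h1 : h * Δ = h * Real.log T / (2 * π * k) := by rw [hΔdef]; ring
    rw [h1, div_le_iff₀ h2πk]
    have h2 : κ ≤ κ * (2 * π * k) := by
      have : (1 : ℝ) ≤ 2 * π * k := by nlinarith [hk1, hπ3]
      nlinarith
    linarith
  -- the prime data
  set Np : ℕ := ⌊Real.exp (2 * π * Δ)⌋₊ with hNp
  set S : Finset ℕ := (Finset.Ioc 0 Np).filter Nat.Prime with hSdef
  have hSprime : ∀ p ∈ S, p.Prime := fun p hp ↦ (Finset.mem_filter.1 hp).2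
  have hSne : ∀ p ∈ S, p ≠ 0 := fun p hp ↦ (hSprime p hp).ne_zero
  have hSN : ∀ p ∈ S, p ≤ Np := fun p hp ↦ (Finset.mem_Ioc.1 (Finset.mem_filter.1 hp).1).2
  have hexp1 : (1 : ℝ) ≤ Real.exp (2 * π * Δ) := Real.one_le_exp (by positivity)
  have hNp1 : 1 ≤ Np := Nat.le_floor (by exact_mod_cast hexp1)
  have hNpT : ((Np ^ k : ℕ) : ℝ) ≤ T := by
    have h1 : (Np : ℝ) ≤ Real.exp (2 * π * Δ) := Nat.floor_le (by positivity)
    have h2 : Real.exp (2 * π * Δ) ^ k = T := by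
      rw [← Real.exp_nat_mul, h2πΔ, mul_div_cancel₀ _ hk0.ne', Real.exp_log hT0]
    push_cast
    rw [← h2]
    exact pow_le_pow_left₀ (Nat.cast_nonneg _) h1 k
  set a : ℕ → ℝ := fun p ↦ Real.log p / Real.sqrt p *
    (𝓕 (fun x : ℝ ↦ selbergMajorant Δ (-h) h x) (Real.log p / (2 * π))).re with hadef
  set Pc : ℝ → ℂ := fun t ↦ ∑ p ∈ S, (a p : ℂ) * (p : ℂ) ^ ((t : ℂ) * I) with hPc
  have hPc_cont : Continuous Pc := continuous_primePoly S hSne _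
  have hre : ∀ t : ℝ, (Pc t).re = ∑ p ∈ S, a p * Real.cos (t * Real.log p) := by
    intro t
    rw [hPc, Complex.re_sum]
    refine Finset.sum_congr rfl fun p hp ↦ ?_
    rw [Complex.re_ofReal_mul, re_natCast_cpow_mul_I (hSne p hp)]
  -- `Σ_p a_p² ≤ Ba`
  have ha2 : ∑ p ∈ S, ‖(a p : ℂ)‖ ^ 2 ≤ Ba := by
    have hw : ∀ p ∈ S, (a p) ^ 2 ≤ (2 * h + 1 / Δ) ^ 2 * ((2 * π * Δ) * (Real.log p / p)) := by
      intro p hp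
      have hpP := hSprime p hp
      have hp0 : (0 : ℝ) < p := by exact_mod_cast hpP.pos
      have hlogp0 : 0 ≤ Real.log p := Real.log_nonneg (by exact_mod_cast hpP.one_lt.le)
      have hlogp : Real.log p ≤ 2 * π * Δ := by
        have h1 : (p : ℝ) ≤ Np := by exact_mod_cast hSN p hp
        have h2 : (Np : ℝ) ≤ Real.exp (2 * π * Δ) := Nat.floor_le (by positivity)
        rw [← Real.log_exp (2 * π * Δ)]
        exact Real.log_le_log hp0 (h1.trans h2)
      have hF := ShortIntervalsRH.abs_re_fourier_selbergMajorant_le hΔ0 hh0.le (Real.log p / (2 * π))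
      have hsq : (a p) ^ 2 = (Real.log p) ^ 2 / p *
          ((𝓕 (fun x : ℝ ↦ selbergMajorant Δ (-h) h x) (Real.log p / (2 * π))).re) ^ 2 := by
        rw [hadef]; dsimp only
        rw [mul_pow, div_pow, Real.sq_sqrt hp0.le]
      rw [hsq]
      have h3 : ((𝓕 (fun x : ℝ ↦ selbergMajorant Δ (-h) h x) (Real.log p / (2 * π))).re) ^ 2 ≤
          (2 * h + 1 / Δ) ^ 2 := by
        rw [← sq_abs]
        exact pow_le_pow_left₀ (abs_nonneg _) hF 2
      have h4 : (Real.log p) ^ 2 / p ≤ (2 * π * Δ) * (Real.log p / p) := by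
        rw [pow_two, mul_div_assoc]
        exact mul_le_mul_of_nonneg_right hlogp (div_nonneg hlogp0 hp0.le)
      calc (Real.log p) ^ 2 / p * ((𝓕 (fun x : ℝ ↦ selbergMajorant Δ (-h) h x) (Real.log p / (2 * π))).re) ^ 2
          ≤ ((2 * π * Δ) * (Real.log p / p)) * (2 * h + 1 / Δ) ^ 2 :=
            mul_le_mul h4 h3 (sq_nonneg _) (by positivity)
        _ = (2 * h + 1 / Δ) ^ 2 * ((2 * π * Δ) * (Real.log p / p)) := by ring
    -- `Σ_{p ≤ Np} log p/p ≤ Σ_{m ≤ Np} Λ(m)/m ≤ 2πΔ + 6`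
    have hM : ∑ p ∈ S, Real.log p / p ≤ 2 * π * Δ + 6 := by
      have hM0 := Literature.NumberTheory.Sieve.SelbergSymmetry.abs_sum_vonMangoldt_div_sub_log_le hexp1
      rw [Real.log_exp, ← hNp] at hM0
      have hM1 := (abs_le.1 hM0).2
      calc ∑ p ∈ S, Real.log p / p
          = ∑ p ∈ S, (vonMangoldt p : ℝ) / p := by
            refine Finset.sum_congr rfl fun p hp ↦ ?_
            rw [ArithmeticFunction.vonMangoldt_apply_prime (hSprime p hp)]
        _ ≤ ∑ m ∈ Finset.Ioc 0 Np, (vonMangoldt m : ℝ) / m :=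
            Finset.sum_le_sum_of_subset_of_nonneg (Finset.filter_subset _ _) fun m _ _ ↦
              div_nonneg ArithmeticFunction.vonMangoldt_nonneg (Nat.cast_nonneg _)
        _ ≤ 2 * π * Δ + 6 := by linarith
    have h6Δ : 6 / Δ ≤ 3 := by rw [div_le_iff₀ hΔ0]; linarith
    calc ∑ p ∈ S, ‖(a p : ℂ)‖ ^ 2 = ∑ p ∈ S, (a p) ^ 2 := by
          refine Finset.sum_congr rfl fun p _ ↦ ?_
          rw [Complex.norm_real, Real.norm_eq_abs, sq_abs]
      _ ≤ ∑ p ∈ S, (2 * h + 1 / Δ) ^ 2 * ((2 * π * Δ) * (Real.log p / p)) := Finset.sum_le_sum hw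
      _ = (2 * h + 1 / Δ) ^ 2 * (2 * π * Δ) * ∑ p ∈ S, Real.log p / p := by
          rw [Finset.mul_sum]; refine Finset.sum_congr rfl fun p _ ↦ by ring
      _ ≤ (2 * h + 1 / Δ) ^ 2 * (2 * π * Δ) * (2 * π * Δ + 6) :=
          mul_le_mul_of_nonneg_left hM (by positivity)
      _ = (2 * (h * Δ) + 1) ^ 2 * (2 * π * (2 * π + 6 / Δ)) := by
          field_simp
      _ ≤ (2 * κ + 1) ^ 2 * (2 * π * (2 * π + 3)) := by
          have h1 : (2 * (h * Δ) + 1) ^ 2 ≤ (2 * κ + 1) ^ 2 :=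
            pow_le_pow_left₀ (by positivity) (by linarith) 2
          have h2 : 2 * π * (2 * π + 6 / Δ) ≤ 2 * π * (2 * π + 3) :=
            mul_le_mul_of_nonneg_left (by linarith) (by positivity)
          exact mul_le_mul h1 h2 (by positivity) (by positivity)
  -- the pointwise bound on `[T, 2T]`
  have hpt : ∀ t ∈ Set.Icc T (2 * T),
      ((zetaZeroCount (t + h) : ℝ) - zetaZeroCount (t - h)) ≤ A + 1 / π * ‖Pc t‖ := by
    intro t ht
    have ht4 : 4 ≤ t := hT4.trans ht.1
    have ht0 : 0 < t := by linarith
    have hexpt : Real.exp (π * Δ) ≤ t := by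
      have h1 : π * Δ ≤ Real.log T := by
        have : π * Δ = Real.log T / (2 * k) := by rw [hΔdef]; field_simp
        rw [this, div_le_iff₀ (by positivity)]
        have : Real.log T * 1 ≤ Real.log T * (2 * k) := mul_le_mul_of_nonneg_left (by linarith) hlogT0.le
        linarith
      calc Real.exp (π * Δ) ≤ Real.exp (Real.log T) := Real.exp_le_exp.2 h1
        _ = T := Real.exp_log hT0
        _ ≤ t := ht.1
    have hmain := hC₁ t Δ h ht4 hΔ2 hexpt hh0 hh1
    rw [← hSdef] at hmain
    have hsum : ∑ p ∈ S, Real.log p / Real.sqrt p *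
        (𝓕 (fun x : ℝ ↦ selbergMajorant Δ (-h) h x) (Real.log p / (2 * π))).re * Real.cos (t * Real.log p) =
        (Pc t).re := by
      rw [hre t]
    rw [hsum] at hmain
    -- the three explicit pieces
    have hlogt : Real.log t ≤ 2 * Real.log T :=
      (Real.log_le_log ht0 ht.2).trans hlog2T
    have hp1 : 2 * h * Real.log (t / (2 * π)) / (2 * π) ≤ 2 * κ / π := by
      have h1 : Real.log (t / (2 * π)) ≤ Real.log t := by
        refine Real.log_le_log (by positivity) ?_
        rw [div_le_iff₀ (by positivity)]; nlinarith
      have h2 : h * Real.log (t / (2 * π)) ≤ h * (2 * Real.log T) :=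
        mul_le_mul_of_nonneg_left (h1.trans hlogt) hh0.le
      have h3 : 2 * h * Real.log (t / (2 * π)) / (2 * π) = h * Real.log (t / (2 * π)) / π := by
        field_simp
      rw [h3]
      exact div_le_div_of_nonneg_right (by nlinarith) hπ0.le
    have hp2 : Real.log t / (2 * π * Δ) ≤ 2 * k := by
      rw [h2πΔ, div_div_eq_mul_div, div_le_iff₀ hlogT0]
      nlinarith
    have hp3 : C₁ * (1 + h * Δ) ≤ |C₁| * (1 + κ) := by
      calc C₁ * (1 + h * Δ) ≤ |C₁| * (1 + h * Δ) :=
            mul_le_mul_of_nonneg_right (le_abs_self _) (by positivity)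
        _ ≤ |C₁| * (1 + κ) := mul_le_mul_of_nonneg_left (by linarith) (abs_nonneg _)
    have hp4 : -(1 / π * (Pc t).re) ≤ 1 / π * ‖Pc t‖ := by
      have : -(Pc t).re ≤ ‖Pc t‖ := by
        have := Complex.abs_re_le_norm (Pc t)
        have := neg_abs_le (Pc t).re
        linarith
      have h0 : (0 : ℝ) ≤ 1 / π := by positivity
      nlinarith
    rw [hA]
    linarith
  -- raise to the power `2k`
  have hpt2 : ∀ t ∈ Set.Icc T (2 * T),
      ((zetaZeroCount (t + h) : ℝ) - zetaZeroCount (t - h)) ^ (2 * k) ≤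
        2 ^ (2 * k) * A ^ (2 * k) + (2 / π) ^ (2 * k) * ‖Pc t‖ ^ (2 * k) := by
    intro t ht
    have hW0 := windowCount_nonneg hh0.le t
    calc ((zetaZeroCount (t + h) : ℝ) - zetaZeroCount (t - h)) ^ (2 * k)
        ≤ (A + 1 / π * ‖Pc t‖) ^ (2 * k) := pow_le_pow_left₀ hW0 (hpt t ht) _
      _ ≤ 2 ^ (2 * k) * (A ^ (2 * k) + (1 / π * ‖Pc t‖) ^ (2 * k)) :=
          add_pow_le_two_pow_mul hA0 (by positivity) _
      _ = 2 ^ (2 * k) * A ^ (2 * k) + (2 / π) ^ (2 * k) * ‖Pc t‖ ^ (2 * k) := by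
          rw [mul_pow, mul_add, ← mul_assoc, ← mul_pow (2 : ℝ) (1 / π) (2 * k),
            show (2 : ℝ) * (1 / π) = 2 / π by ring]
  -- integrate over `[T, 2T]`
  have hT2T : T ≤ 2 * T := by linarith
  have hWint : IntervalIntegrable (fun t : ℝ ↦ ((zetaZeroCount (t + h) : ℝ) - zetaZeroCount (t - h)) ^ (2 * k))
      volume T (2 * T) := by
    refine intervalIntegrable_of_bounded (C := (zetaZeroCount (2 * T + 1) : ℝ) ^ (2 * k)) hT2T
      ((measurable_windowCount h).pow_const _) fun t ht ↦ ?_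
    have hW0 := windowCount_nonneg hh0.le t
    rw [abs_of_nonneg (pow_nonneg hW0 _)]
    exact pow_le_pow_left₀ hW0 (windowCount_le (by linarith [ht.2])) _
  have hBint : IntervalIntegrable (fun t : ℝ ↦ 2 ^ (2 * k) * A ^ (2 * k) + (2 / π) ^ (2 * k) * ‖Pc t‖ ^ (2 * k))
      volume T (2 * T) :=
    (continuous_const.add (continuous_const.mul (hPc_cont.norm.pow _))).intervalIntegrable _ _
  have hPint : IntervalIntegrable (fun t : ℝ ↦ ‖Pc t‖ ^ (2 * k)) volume 0 (2 * T) :=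
    (hPc_cont.norm.pow _).intervalIntegrable _ _
  have hstep1 : ∫ t in T..2 * T, ((zetaZeroCount (t + h) : ℝ) - zetaZeroCount (t - h)) ^ (2 * k) ≤
      ∫ t in T..2 * T, (2 ^ (2 * k) * A ^ (2 * k) + (2 / π) ^ (2 * k) * ‖Pc t‖ ^ (2 * k)) :=
    intervalIntegral.integral_mono_on hT2T hWint hBint hpt2
  have hI0 : IntervalIntegrable (fun _ : ℝ ↦ (2 : ℝ) ^ (2 * k) * A ^ (2 * k)) volume T (2 * T) :=
    intervalIntegrable_const
  have hI1 : IntervalIntegrable (fun t : ℝ ↦ (2 / π) ^ (2 * k) * ‖Pc t‖ ^ (2 * k)) volume T (2 * T) :=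
    (continuous_const.mul (hPc_cont.norm.pow _)).intervalIntegrable _ _
  have hstep2 : ∫ t in T..2 * T, (2 ^ (2 * k) * A ^ (2 * k) + (2 / π) ^ (2 * k) * ‖Pc t‖ ^ (2 * k)) =
      2 ^ (2 * k) * A ^ (2 * k) * T + (2 / π) ^ (2 * k) * ∫ t in T..2 * T, ‖Pc t‖ ^ (2 * k) := by
    rw [intervalIntegral.integral_add hI0 hI1, intervalIntegral.integral_const,
      intervalIntegral.integral_const_mul, smul_eq_mul]
    ring
  have hstep3 : ∫ t in T..2 * T, ‖Pc t‖ ^ (2 * k) ≤ ∫ t in (0 : ℝ)..2 * T, ‖Pc t‖ ^ (2 * k) :=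
    intervalIntegral.integral_mono_interval hT0.le hT2T le_rfl
      (Eventually.of_forall fun t ↦ by positivity) hPint
  have hstep4 : ∫ t in (0 : ℝ)..2 * T, ‖Pc t‖ ^ (2 * k) ≤ 930 * T * (k.factorial * Ba ^ k) := by
    have h1 := integral_norm_primePoly_pow_le S hSprime hNp1 hSN (fun p ↦ (a p : ℂ)) k (T := 2 * T)
      (by linarith)
    have h2 : (2 * T + 928 * (Np : ℝ) ^ k) ≤ 930 * T := by
      have : (Np : ℝ) ^ k ≤ T := by exact_mod_cast hNpT
      linarith
    have h3 : (k.factorial * (∑ p ∈ S, ‖(a p : ℂ)‖ ^ 2) ^ k : ℝ) ≤ k.factorial * Ba ^ k :=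
      mul_le_mul_of_nonneg_left (pow_le_pow_left₀ (Finset.sum_nonneg fun p _ ↦ by positivity) ha2 k)
        (Nat.cast_nonneg _)
    calc ∫ t in (0 : ℝ)..2 * T, ‖Pc t‖ ^ (2 * k)
        ≤ (2 * T + 928 * (Np : ℝ) ^ k) * (k.factorial * (∑ p ∈ S, ‖(a p : ℂ)‖ ^ 2) ^ k) := h1
      _ ≤ 930 * T * (k.factorial * Ba ^ k) :=
          mul_le_mul h2 h3 (by positivity) (by positivity)
  have h2π : (0 : ℝ) ≤ (2 / π) ^ (2 * k) := by positivity
  calc ∫ t in T..2 * T, ((zetaZeroCount (t + h) : ℝ) - zetaZeroCount (t - h)) ^ (2 * k)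
      ≤ 2 ^ (2 * k) * A ^ (2 * k) * T + (2 / π) ^ (2 * k) * ∫ t in T..2 * T, ‖Pc t‖ ^ (2 * k) := by
        rw [← hstep2]; exact hstep1
    _ ≤ 2 ^ (2 * k) * A ^ (2 * k) * T + (2 / π) ^ (2 * k) * (930 * T * (k.factorial * Ba ^ k)) := by
        have := hstep3.trans hstep4
        nlinarith
    _ = C * T := by rw [hC]; ring

/-! ## Lemma 2, cumulative form: `∫_{T₁}^{T} W_h^{2k} ≪ T` (dyadic induction) -/

/-- `W_h^n` is interval integrable on every `[a, b]` (`h ≥ 0`): it is measurable and bounded by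
`N(b+h)^n` there. [cite: Titchmarsh1986, §9.1] -/
theorem intervalIntegrable_windowCount_pow {h : ℝ} (hh : 0 ≤ h) (n : ℕ) {a b : ℝ} (hab : a ≤ b) :
    IntervalIntegrable (fun t : ℝ ↦ ((zetaZeroCount (t + h) : ℝ) - zetaZeroCount (t - h)) ^ n)
      volume a b := by
  refine intervalIntegrable_of_bounded (C := (zetaZeroCount (b + h) : ℝ) ^ n) hab
    ((measurable_windowCount h).pow_const _) fun t ht ↦ ?_
  have hW0 := windowCount_nonneg hh t
  rw [abs_of_nonneg (pow_nonneg hW0 _)]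
  exact pow_le_pow_left₀ hW0 (windowCount_le (by linarith [ht.2])) _

/-- **Lemma 2, cumulative form.** Under RH, for every `κ > 0` and `k ≥ 1` there are `C ≥ 0` and
`T₁ ≥ 8` such that `∫_{T₁}^{T} (N(t+h) − N(t−h))^{2k} dt ≤ C T` for all `T ≥ T₁` and
`0 < h ≤ κ/log T` (sum the dyadic bound over `[T/2, T], [T/4, T/2], …`; the hypothesis
`h ≤ κ/log T` only gets weaker on the way down). [cite: BuiEtAl2023, Lemma 2] -/
theorem integral_windowCount_pow_le_of_RH_cumulative (hRH : RiemannHypothesis) {κ : ℝ} (hκ : 0 < κ)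
    {k : ℕ} (hk : 1 ≤ k) :
    ∃ C T₁ : ℝ, 0 ≤ C ∧ 8 ≤ T₁ ∧ ∀ T : ℝ, T₁ ≤ T → ∀ h : ℝ, 0 < h → h ≤ κ / Real.log T →
      ∫ t in T₁..T, ((zetaZeroCount (t + h) : ℝ) - zetaZeroCount (t - h)) ^ (2 * k) ≤ C * T := by
  obtain ⟨C, T₀, hC0, hT₀, hmain⟩ := integral_windowCount_pow_le_of_RH hRH hκ hk
  refine ⟨C, 2 * T₀, hC0, by linarith, ?_⟩
  -- `h ≤ κ/log T` is inherited by smaller `T' ≥ 2`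
  have hinherit : ∀ {T T' h : ℝ}, 2 ≤ T' → T' ≤ T → h ≤ κ / Real.log T → h ≤ κ / Real.log T' := by
    intro T T' h hT' hT'T hh
    have h1 : 0 < Real.log T' := Real.log_pos (by linarith)
    exact hh.trans (div_le_div_of_nonneg_left hκ.le h1 (Real.log_le_log (by linarith) hT'T))
  set W : ℝ → ℝ → ℝ := fun h t ↦ ((zetaZeroCount (t + h) : ℝ) - zetaZeroCount (t - h)) ^ (2 * k) with hW
  -- induction on the dyadic scale
  have key : ∀ m : ℕ, ∀ T : ℝ, 2 * T₀ ≤ T → T ≤ 2 ^ m * (2 * T₀) → ∀ h : ℝ, 0 < h →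
      h ≤ κ / Real.log T → ∫ t in (2 * T₀)..T, W h t ≤ C * T := by
    intro m
    induction m with
    | zero =>
      intro T hT hTm h hh0 _
      have hTeq : T = 2 * T₀ := le_antisymm (by simpa using hTm) hT
      rw [hTeq, intervalIntegral.integral_same]
      positivity
    | succ m ih =>
      intro T hT hTm h hh0 hh
      by_cases hcase : T ≤ 2 ^ m * (2 * T₀)
      · exact ih T hT hcase h hh0 hh
      push Not at hcase
      have hT2 : T₀ ≤ T / 2 := by linarith
      have hT2' : 2 ≤ T / 2 := by linarith
      have hh' : h ≤ κ / Real.log (T / 2) := hinherit hT2' (by linarith) hh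
      -- the top dyadic block `[T/2, T]`
      have htop : ∫ t in (T / 2)..T, W h t ≤ C * (T / 2) := by
        have := hmain (T / 2) hT2 h hh0 hh'
        rwa [show 2 * (T / 2) = T by ring] at this
      have hWi : ∀ a b : ℝ, a ≤ b → IntervalIntegrable (W h) volume a b := fun a b hab ↦
        intervalIntegrable_windowCount_pow hh0.le _ hab
      by_cases hlow : T / 2 ≤ 2 * T₀
      · -- `∫_{2T₀}^{T} ≤ ∫_{T/2}^{T}`
        calc ∫ t in (2 * T₀)..T, W h t ≤ ∫ t in (T / 2)..T, W h t :=
              intervalIntegral.integral_mono_interval hlow hT le_rfl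
                (Eventually.of_forall fun t ↦ pow_nonneg (windowCount_nonneg hh0.le t) _)
                (hWi _ _ (by linarith))
          _ ≤ C * (T / 2) := htop
          _ ≤ C * T := by nlinarith
      · push Not at hlow
        have hTm' : T / 2 ≤ 2 ^ m * (2 * T₀) := by
          rw [pow_succ] at hTm; linarith
        have hbot := ih (T / 2) hlow.le hTm' h hh0 hh'
        rw [← intervalIntegral.integral_add_adjacent_intervals (hWi _ _ hlow.le) (hWi _ _ (by linarith))]
        linarith
  intro T hT h hh0 hh
  -- choose the dyadic scale
  obtain ⟨m, hm⟩ := pow_unbounded_of_one_lt (T / (2 * T₀)) (by norm_num : (1 : ℝ) < 2)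
  have hTm : T ≤ 2 ^ m * (2 * T₀) := by
    rw [div_lt_iff₀ (by linarith)] at hm; exact hm.le
  exact key m T hT hTm h hh0 hh

/-! ## Proposition 2: `Σ_{γ ≤ T} W_δ(γ)^j ≪ T log T` -/

/-- `#{n : γ_n ≤ x} = N(x)` in `Finset` form: the indices with `γ_n ≤ x` inside any `range M`
containing them number `N(x)`; here as the filter of `range M` for `M ≥ N(x)`.
[cite: Titchmarsh1986, §9.1] -/
theorem card_filter_zetaOrdinate_le {x : ℝ} {M : ℕ} (hM : zetaZeroCount x ≤ M) :
    ((Finset.range M).filter fun n ↦ zetaOrdinate n ≤ x).card = zetaZeroCount x := by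
  have hset : ((Finset.range M).filter fun n ↦ zetaOrdinate n ≤ x) = Finset.range (zetaZeroCount x) := by
    ext n
    simp only [Finset.mem_filter, Finset.mem_range]
    constructor
    · rintro ⟨-, hn⟩
      have := (mem_zeroIndexSet_iff_holds (T := x) (n := n)).2 hn
      simpa [zeroIndexSet] using this
    · intro hn
      refine ⟨lt_of_lt_of_le hn hM, ?_⟩
      exact (mem_zeroIndexSet_iff_holds (T := x) (n := n)).1 (by simpa [zeroIndexSet] using hn)
  rw [hset, Finset.card_range]

/-- **The number of ordinates in `(t − w, t + w]` is `N(t+w) − N(t−w)`**, hence the number of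
indices `n < M` with `t − w < γ_n ≤ t + w` is at most `W_h(t)` for `w ≤ h`.
[cite: Titchmarsh1986, §9.1] -/
theorem card_filter_window_le {t w h : ℝ} (hw : 0 ≤ w) (hwh : w ≤ h) (M : ℕ) :
    (((Finset.range M).filter fun n ↦ t - w < zetaOrdinate n ∧ zetaOrdinate n ≤ t + w).card : ℝ) ≤
      (zetaZeroCount (t + h) : ℝ) - zetaZeroCount (t - h) := by
  classical
  -- enlarge `M` so that it contains all indices with `γ_n ≤ t + w`
  set M' : ℕ := max M (zetaZeroCount (t + w)) with hM'
  have hsub : ((Finset.range M).filter fun n ↦ t - w < zetaOrdinate n ∧ zetaOrdinate n ≤ t + w) ⊆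
      ((Finset.range M').filter fun n ↦ zetaOrdinate n ≤ t + w) \
        ((Finset.range M').filter fun n ↦ zetaOrdinate n ≤ t - w) := by
    intro n hn
    rw [Finset.mem_filter, Finset.mem_range] at hn
    rw [Finset.mem_sdiff, Finset.mem_filter, Finset.mem_filter, Finset.mem_range]
    refine ⟨⟨lt_of_lt_of_le hn.1 (le_max_left _ _), hn.2.2⟩, fun h' ↦ ?_⟩
    linarith [h'.2, hn.2.1]
  have hsub2 : ((Finset.range M').filter fun n ↦ zetaOrdinate n ≤ t - w) ⊆
      ((Finset.range M').filter fun n ↦ zetaOrdinate n ≤ t + w) :=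
    Finset.monotone_filter_right _ fun n _ (hn : zetaOrdinate n ≤ t - w) ↦ by
      show zetaOrdinate n ≤ t + w; linarith
  have hc1 := card_filter_zetaOrdinate_le (x := t + w) (M := M') (le_max_right _ _)
  have hc2 := card_filter_zetaOrdinate_le (x := t - w) (M := M')
    ((zetaZeroCount_mono (by linarith : t - w ≤ t + w)).trans (le_max_right _ _))
  have hcard := (Finset.card_le_card hsub).trans_eq (Finset.card_sdiff_of_subset hsub2)
  rw [hc1, hc2] at hcard
  have h1 : (zetaZeroCount (t + w) : ℝ) ≤ zetaZeroCount (t + h) := by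
    exact_mod_cast zetaZeroCount_mono (by linarith)
  have h2 : (zetaZeroCount (t - h) : ℝ) ≤ zetaZeroCount (t - w) := by
    exact_mod_cast zetaZeroCount_mono (by linarith)
  have h3 : zetaZeroCount (t - w) ≤ zetaZeroCount (t + w) := zetaZeroCount_mono (by linarith)
  have h4 : (((Finset.range M).filter fun n ↦ t - w < zetaOrdinate n ∧ zetaOrdinate n ≤ t + w).card : ℝ)
      ≤ ((zetaZeroCount (t + w) - zetaZeroCount (t - w) : ℕ) : ℝ) := by exact_mod_cast hcard
  rw [Nat.cast_sub h3] at h4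
  linarith

/-- The window count is a natural number: `W_h(t) = ((N(t+h) − N(t−h) : ℕ) : ℝ)` (`h ≥ 0`), so
that `W^{i} ≤ W^{j}` for `1 ≤ i ≤ j` ("`n(t,k+1)` is a nonnegative integer, so
`n(t,k+1)^{2k+1} ≤ n(t,k+1)^{2k+2}`"). [cite: BuiEtAl2023, Proposition 2 (proof)] -/
theorem windowCount_pow_le_pow {h : ℝ} (hh : 0 ≤ h) (t : ℝ) {i j : ℕ} (hi : 1 ≤ i) (hij : i ≤ j) :
    ((zetaZeroCount (t + h) : ℝ) - zetaZeroCount (t - h)) ^ i ≤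
      ((zetaZeroCount (t + h) : ℝ) - zetaZeroCount (t - h)) ^ j := by
  have hle : zetaZeroCount (t - h) ≤ zetaZeroCount (t + h) := zetaZeroCount_mono (by linarith)
  have hnat : ((zetaZeroCount (t + h) : ℝ) - zetaZeroCount (t - h)) =
      ((zetaZeroCount (t + h) - zetaZeroCount (t - h) : ℕ) : ℝ) := by
    rw [Nat.cast_sub hle]
  rw [hnat]
  rcases Nat.eq_zero_or_pos (zetaZeroCount (t + h) - zetaZeroCount (t - h)) with h0 | hpos
  · rw [h0]; simp [zero_pow (by omega : i ≠ 0), zero_pow (by omega : j ≠ 0)]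
  · exact pow_le_pow_right₀ (by exact_mod_cast hpos) hij

set_option maxHeartbeats 1600000 in
/-- **Bui–Goldston–Milinovich–Montgomery 2023, Proposition 2 (symmetric window, `k` fixed), under
RH.** For every `κ > 0` and `j` there are `C ≥ 0` and `T₀` such that for all `T ≥ T₀` and
`0 < δ ≤ κ/log T`,
`Σ_{n < N(T)} (N(γ_n + δ) − N(γ_n − δ))^j ≤ C · T · log T`
(sum over the zeros `0 < γ ≤ T` with multiplicity, `γ_n = zetaOrdinate n`). Printed:
`Σ_{0<γ≤T} n(γ,k)^{2k} ≤ (Ck)^{2k} T log T` and `Σ_{0<γ_d≤T} m(γ_d)^{2k} < (Ck)^{2k−1} T log T`;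
both one-sided window counts and the multiplicity `m(γ)` are `≤ N(γ+δ) − N(γ−δ)`. Proof as printed:
for `t ∈ J(γ) = [γ − w, γ]`, `w = 1/log T`, one has `W_δ(γ) ≤ W_{δ+w}(t)`; averaging over `J(γ)`
and summing over `γ`, the overlap of the `J(γ)` at `t` is the number of ordinates in `[t, t+w]`,
`≤ W_{δ+w}(t)`; so `w Σ_γ W_δ(γ)^j ≤ ∫ W^{j+1} ≤ ∫ W^{2k}` (`W ∈ ℕ`) `≪ T` by Lemma 2.
[cite: BuiEtAl2023, Proposition 2] -/
theorem sum_windowCount_pow_le_of_RH (hRH : RiemannHypothesis) {κ : ℝ} (hκ : 0 < κ) (j : ℕ) :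
    ∃ C T₀ : ℝ, 0 ≤ C ∧ 8 ≤ T₀ ∧ ∀ T : ℝ, T₀ ≤ T → ∀ δ : ℝ, 0 < δ → δ ≤ κ / Real.log T →
      ∑ n ∈ zeroIndexSet T,
          ((zetaZeroCount (zetaOrdinate n + δ) : ℝ) - zetaZeroCount (zetaOrdinate n - δ)) ^ j ≤
        C * T * Real.log T := by
  classical
  -- Lemma 2 (cumulative) with `κ' = κ + 1` and `k = j + 1`
  have hκ1 : 0 < κ + 1 := by linarith
  obtain ⟨C₁, T₁, hC₁, hT₁, hmom⟩ :=
    integral_windowCount_pow_le_of_RH_cumulative hRH hκ1 (k := j + 1) (by omega)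
  -- constants
  set K₀ : ℝ := (zetaZeroCount (T₁ + 1) : ℝ) * (zetaZeroCount (T₁ + 2) : ℝ) ^ j with hK₀
  have hK₀0 : 0 ≤ K₀ := by positivity
  set T₂ : ℝ := max (T₁ + 1) (Real.exp (κ + 1)) with hT₂
  refine ⟨C₁ + K₀, T₂, by positivity, ?_, fun T hT δ hδ0 hδ ↦ ?_⟩
  · have : T₁ + 1 ≤ T₂ := le_max_left _ _
    linarith
  have hTT₁ : T₁ + 1 ≤ T := (le_max_left _ _).trans hT
  have hT0 : 0 < T := by linarith
  have hTexp : Real.exp (κ + 1) ≤ T := (le_max_right _ _).trans hT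
  have hlogT : κ + 1 ≤ Real.log T := by
    rw [← Real.log_exp (κ + 1)]; exact Real.log_le_log (Real.exp_pos _) hTexp
  have hlogT0 : 0 < Real.log T := by linarith
  have hlogT1 : 1 ≤ Real.log T := by linarith
  -- `w = 1/log T`, `h = δ + w`
  set w : ℝ := 1 / Real.log T with hwdef
  have hw0 : 0 < w := by positivity
  have hw1 : w ≤ 1 := (div_le_one hlogT0).2 hlogT1
  have hδ1 : δ ≤ 1 := hδ.trans ((div_le_one hlogT0).2 (by linarith))
  set h : ℝ := δ + w with hhdef
  have hh0 : 0 < h := by positivity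
  have hhκ : h ≤ (κ + 1) / Real.log T := by
    rw [hhdef, hwdef, add_div]; exact add_le_add hδ le_rfl
  have hwh : w ≤ h := by linarith
  -- notation
  set Wδ : ℕ → ℝ := fun n ↦
    ((zetaZeroCount (zetaOrdinate n + δ) : ℝ) - zetaZeroCount (zetaOrdinate n - δ)) with hWδ
  set Wh : ℝ → ℝ := fun t ↦ ((zetaZeroCount (t + h) : ℝ) - zetaZeroCount (t - h)) with hWh
  have hWδ0 : ∀ n, 0 ≤ Wδ n := fun n ↦ windowCount_nonneg hδ0.le _
  have hWh0 : ∀ t, 0 ≤ Wh t := fun t ↦ windowCount_nonneg hh0.le t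
  -- split the zeros at height `T₁ + 1`
  set R₀ : Finset ℕ := zeroIndexSet (T₁ + 1) with hR₀
  set R : Finset ℕ := zeroIndexSet T \ zeroIndexSet (T₁ + 1) with hR
  have hR₀sub : R₀ ⊆ zeroIndexSet T := by
    rw [hR₀]; unfold zeroIndexSet
    exact Finset.range_subset_range.2 (zetaZeroCount_mono hTT₁)
  have hsplit : ∑ n ∈ zeroIndexSet T, Wδ n ^ j = ∑ n ∈ R₀, Wδ n ^ j + ∑ n ∈ R, Wδ n ^ j := by
    rw [hR, ← Finset.sum_sdiff hR₀sub, add_comm]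
  -- the low zeros: a constant
  have hlow : ∑ n ∈ R₀, Wδ n ^ j ≤ K₀ := by
    have hb : ∀ n ∈ R₀, Wδ n ^ j ≤ (zetaZeroCount (T₁ + 2) : ℝ) ^ j := by
      intro n hn
      have hγ : zetaOrdinate n ≤ T₁ + 1 := (mem_zeroIndexSet_iff_holds (T := T₁ + 1) (n := n)).1 hn
      refine pow_le_pow_left₀ (hWδ0 n) ?_ _
      exact windowCount_le (by linarith)
    calc ∑ n ∈ R₀, Wδ n ^ j ≤ ∑ n ∈ R₀, (zetaZeroCount (T₁ + 2) : ℝ) ^ j := Finset.sum_le_sum hb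
      _ = (R₀.card : ℝ) * (zetaZeroCount (T₁ + 2) : ℝ) ^ j := by rw [Finset.sum_const, nsmul_eq_mul]
      _ = K₀ := by rw [hK₀, hR₀, card_zeroIndexSet]
  -- the high zeros: `γ_n ∈ (T₁ + 1, T]`
  have hRmem : ∀ n ∈ R, T₁ + 1 < zetaOrdinate n ∧ zetaOrdinate n ≤ T := by
    intro n hn
    rw [hR, Finset.mem_sdiff] at hn
    exact ⟨not_le.1 fun h' ↦ hn.2 ((mem_zeroIndexSet_iff_holds (T := T₁ + 1) (n := n)).2 h'),
      (mem_zeroIndexSet_iff_holds (T := T) (n := n)).1 hn.1⟩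
  -- (i) averaging over `J(γ_n) = (γ_n − w, γ_n]`:
  --     `w · W_δ(γ_n)^j ≤ ∫_{T₁}^{T} 𝟙_{(γ_n − w, γ_n]}(t) W_h(t)^j dt`
  have hWhi : IntervalIntegrable (fun t ↦ Wh t ^ j) volume T₁ T :=
    intervalIntegrable_windowCount_pow hh0.le _ (by linarith)
  have hT₁T : T₁ ≤ T := by linarith
  have havg : ∀ n ∈ R, w * Wδ n ^ j ≤
      ∫ t in T₁..T, (Set.Ioc (zetaOrdinate n - w) (zetaOrdinate n)).indicator (fun t ↦ Wh t ^ j) t := by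
    intro n hn
    obtain ⟨hγ1, hγT⟩ := hRmem n hn
    set γ := zetaOrdinate n with hγdef
    have hI : Set.Ioc (γ - w) γ ⊆ Set.Ioc T₁ T := fun t ht ↦ ⟨by linarith [ht.1], ht.2.trans hγT⟩
    -- rewrite the right-hand side as `∫_{γ−w}^{γ} W_h^j`
    have hrhs : ∫ t in T₁..T, (Set.Ioc (γ - w) γ).indicator (fun t ↦ Wh t ^ j) t =
        ∫ t in (γ - w)..γ, Wh t ^ j := by
      rw [intervalIntegral.integral_of_le hT₁T, integral_indicator measurableSet_Ioc,
        Measure.restrict_restrict measurableSet_Ioc, Set.inter_eq_self_of_subset_left hI,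
        intervalIntegral.integral_of_le (by linarith)]
    rw [hrhs]
    -- pointwise `W_δ(γ) ≤ W_h(t)` on `[γ − w, γ]`
    have hpt : ∀ t ∈ Set.Icc (γ - w) γ, Wδ n ^ j ≤ Wh t ^ j := by
      intro t ht
      refine pow_le_pow_left₀ (hWδ0 n) ?_ _
      simp only [hWδ, hWh, ← hγdef]
      have h1 : (zetaZeroCount (γ + δ) : ℝ) ≤ zetaZeroCount (t + h) := by
        exact_mod_cast zetaZeroCount_mono (by rw [hhdef]; linarith [ht.1])
      have h2 : (zetaZeroCount (t - h) : ℝ) ≤ zetaZeroCount (γ - δ) := by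
        exact_mod_cast zetaZeroCount_mono (by rw [hhdef]; linarith [ht.2])
      linarith
    have hconst : ∫ t in (γ - w)..γ, Wδ n ^ j = w * Wδ n ^ j := by
      rw [intervalIntegral.integral_const, smul_eq_mul]; ring
    rw [← hconst]
    exact intervalIntegral.integral_mono_on (by linarith) intervalIntegrable_const
      (intervalIntegrable_windowCount_pow hh0.le _ (by linarith)) hpt
  -- (ii) sum over the high zeros and exchange sum and integral
  have hind_int : ∀ n ∈ R, IntervalIntegrable
      (fun t ↦ (Set.Ioc (zetaOrdinate n - w) (zetaOrdinate n)).indicator (fun t ↦ Wh t ^ j) t)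
      volume T₁ T := by
    intro n _
    rw [intervalIntegrable_iff_integrableOn_Ioc_of_le hT₁T]
    exact ((intervalIntegrable_iff_integrableOn_Ioc_of_le hT₁T).1 hWhi).indicator measurableSet_Ioc
  have hsumR : w * ∑ n ∈ R, Wδ n ^ j ≤
      ∫ t in T₁..T, ∑ n ∈ R, (Set.Ioc (zetaOrdinate n - w) (zetaOrdinate n)).indicator (fun t ↦ Wh t ^ j) t := by
    rw [Finset.mul_sum, intervalIntegral.integral_finsetSum hind_int]
    exact Finset.sum_le_sum havg
  -- (iii) the overlap count: `Σ_n 𝟙_{(γ_n − w, γ_n]}(t) · W_h(t)^j ≤ W_h(t) · W_h(t)^j ≤ W_h(t)^{2(j+1)}`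
  have hoverlap : ∀ t : ℝ,
      ∑ n ∈ R, (Set.Ioc (zetaOrdinate n - w) (zetaOrdinate n)).indicator (fun t ↦ Wh t ^ j) t ≤
        Wh t ^ (2 * (j + 1)) := by
    intro t
    have hcount : ∑ n ∈ R, (Set.Ioc (zetaOrdinate n - w) (zetaOrdinate n)).indicator (fun t ↦ Wh t ^ j) t =
        ((R.filter fun n ↦ t ∈ Set.Ioc (zetaOrdinate n - w) (zetaOrdinate n)).card : ℝ) * Wh t ^ j := by
      rw [← Finset.sum_filter_add_sum_filter_not R (fun n ↦ t ∈ Set.Ioc (zetaOrdinate n - w) (zetaOrdinate n))]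
      have h1 : ∑ n ∈ R.filter (fun n ↦ t ∈ Set.Ioc (zetaOrdinate n - w) (zetaOrdinate n)),
          (Set.Ioc (zetaOrdinate n - w) (zetaOrdinate n)).indicator (fun t ↦ Wh t ^ j) t =
          ∑ n ∈ R.filter (fun n ↦ t ∈ Set.Ioc (zetaOrdinate n - w) (zetaOrdinate n)), Wh t ^ j :=
        Finset.sum_congr rfl fun n hn ↦ Set.indicator_of_mem (Finset.mem_filter.1 hn).2 _
      have h2 : ∑ n ∈ R.filter (fun n ↦ ¬ t ∈ Set.Ioc (zetaOrdinate n - w) (zetaOrdinate n)),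
          (Set.Ioc (zetaOrdinate n - w) (zetaOrdinate n)).indicator (fun t ↦ Wh t ^ j) t = 0 :=
        Finset.sum_eq_zero fun n hn ↦ Set.indicator_of_notMem (Finset.mem_filter.1 hn).2 _
      rw [h1, h2, add_zero, Finset.sum_const, nsmul_eq_mul]
    rw [hcount]
    -- the filter is contained in the indices with `t − w < γ_n ≤ t + w`... indeed `t ≤ γ_n < t + w`
    have hcard : ((R.filter fun n ↦ t ∈ Set.Ioc (zetaOrdinate n - w) (zetaOrdinate n)).card : ℝ) ≤ Wh t := by
      have hsub : (R.filter fun n ↦ t ∈ Set.Ioc (zetaOrdinate n - w) (zetaOrdinate n)) ⊆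
          ((Finset.range (zetaZeroCount T)).filter fun n ↦ t - w < zetaOrdinate n ∧ zetaOrdinate n ≤ t + w) := by
        intro n hn
        rw [Finset.mem_filter] at hn ⊢
        have hnR : n ∈ zeroIndexSet T := (Finset.mem_sdiff.1 (by rw [hR] at hn; exact hn.1)).1
        refine ⟨by simpa [zeroIndexSet] using hnR, ?_, ?_⟩
        · linarith [hn.2.2, hw0]
        · linarith [hn.2.1]
      calc ((R.filter fun n ↦ t ∈ Set.Ioc (zetaOrdinate n - w) (zetaOrdinate n)).card : ℝ)
          ≤ (((Finset.range (zetaZeroCount T)).filter fun n ↦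
              t - w < zetaOrdinate n ∧ zetaOrdinate n ≤ t + w).card : ℝ) := by
            exact_mod_cast Finset.card_le_card hsub
        _ ≤ Wh t := card_filter_window_le hw0.le hwh _
    calc ((R.filter fun n ↦ t ∈ Set.Ioc (zetaOrdinate n - w) (zetaOrdinate n)).card : ℝ) * Wh t ^ j
        ≤ Wh t * Wh t ^ j := mul_le_mul_of_nonneg_right hcard (pow_nonneg (hWh0 t) _)
      _ = Wh t ^ (j + 1) := by ring
      _ ≤ Wh t ^ (2 * (j + 1)) := windowCount_pow_le_pow hh0.le t (by omega) (by omega)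
  -- (iv) integrate: `≤ ∫_{T₁}^{T} W_h^{2(j+1)} ≤ C₁ T`
  have hI2 : IntervalIntegrable (fun t ↦ Wh t ^ (2 * (j + 1))) volume T₁ T :=
    intervalIntegrable_windowCount_pow hh0.le _ hT₁T
  have hIsum : IntervalIntegrable
      (fun t ↦ ∑ n ∈ R, (Set.Ioc (zetaOrdinate n - w) (zetaOrdinate n)).indicator (fun t ↦ Wh t ^ j) t)
      volume T₁ T := by
    have hs := IntervalIntegrable.sum R hind_int
    rwa [Finset.sum_fn] at hs
  have hhigh : w * ∑ n ∈ R, Wδ n ^ j ≤ C₁ * T :=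
    calc w * ∑ n ∈ R, Wδ n ^ j
        ≤ ∫ t in T₁..T, ∑ n ∈ R, (Set.Ioc (zetaOrdinate n - w) (zetaOrdinate n)).indicator
            (fun t ↦ Wh t ^ j) t := hsumR
      _ ≤ ∫ t in T₁..T, Wh t ^ (2 * (j + 1)) :=
          intervalIntegral.integral_mono_on hT₁T hIsum hI2 fun t _ ↦ hoverlap t
      _ ≤ C₁ * T := hmom T (by linarith) h hh0 hhκ
  -- (v) assemble: `Σ ≤ K₀ + C₁ T/w = K₀ + C₁ T log T ≤ (C₁ + K₀) T log T`
  have hhigh' : ∑ n ∈ R, Wδ n ^ j ≤ C₁ * T * Real.log T := by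
    have h1 : ∑ n ∈ R, Wδ n ^ j ≤ C₁ * T / w := by
      rw [le_div_iff₀ hw0]; linarith
    have h2 : C₁ * T / w = C₁ * T * Real.log T := by
      rw [hwdef]; field_simp
    linarith
  have hTlog : 1 ≤ T * Real.log T := by nlinarith
  calc ∑ n ∈ zeroIndexSet T, Wδ n ^ j = ∑ n ∈ R₀, Wδ n ^ j + ∑ n ∈ R, Wδ n ^ j := hsplit
    _ ≤ K₀ + C₁ * T * Real.log T := add_le_add hlow hhigh'
    _ ≤ K₀ * (T * Real.log T) + C₁ * T * Real.log T := by nlinarith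
    _ = (C₁ + K₀) * T * Real.log T := by ring

end BGMM2023

end Literature.NumberTheory.LFunctions

end
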